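import Literature.MathematicalPhysics.QuantumFieldTheory.Balaban1983to89.B9Eq375Composition
import Literature.MathematicalPhysics.QuantumFieldTheory.Balaban1983to89.B9Eq372Locality
import Literature.Analysis.Matrix.ExponentialScalarSquare

/-!
# `Balaban1983to89.B9Eq375Locality` — B9, p. 405: the LOCALITY CLAUSE of (3.72)/(3.73) — «It is a local, bounded operator … with the
# same norms |A|, |A′| determined by the set st(b)» — AS IT APPLIES to the operators `F_{2,k}(A)`, `V₂(A)` of (3.75) («where the operators
# F_{2,k}(A), V₂(A) satisfy the bounds (3.72), (3.73)») as typed in `B9Eq375Composition`: the dependence sets at `b`, locality as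
# congruence theorems, a kernel WITNESS that `st(b)` alone is NOT the right set for `V₂`, and (3.72)/(3.73) with the local norms; v1.2
# (v1 = p191610; v1.1 = p191722, docstring only: the (3.37) quotation completed as in `B9Eq375Composition` v1.1 — XREAD adv9-g63, journal
# l.57545, D-1; v1.2 docstring/comment only: «thirteen letter bounds» → twelve at the three loci of `norm_sBracket₂_le_loc` (the proof
# uses exactly twelve: three on `A`, three on `A′`, three on `D¹A`, three on `D¹A′`) — XREAD adv6-g64, journal l.58180, D1 LOW)

CITATION HEADER (lean-in-tree rule).  Audit cell `pub-balaban`, surge node-prover lineage pv27 (B9 pp. 390–392, 396–397, 404–405),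
unit `b2b-balaban-pv27-g19` (journal CLAIM l.57468, node B9-EQ375-LOCALITY; second node of the seat, after B9-EQ375-COMPOSITION =
`B9Eq375Composition` (p191250) — imported, together with the lineage's `st(b)` leaf `B9Eq372Locality` (p190900, unit `…-g18`)).
Source: T. Bałaban, *Propagators for lattice gauge theories in a background field*, Commun. Math. Phys. **99** (1985) 389–434
[Balaban1985BackgroundPropagators] (cell paper B9; journal page = PDF page + 388), p. 405 [PDF 17] ((3.75) and its norm sentence,
(3.72), (3.73)) and p. 404 [PDF 16] (the definition of `st(b)` after (3.69)), with (3.37) p. 396 [PDF 8] and (3.39) p. 397 [PDF 9],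
quoted from the page renders `b2b-balaban-ref1/pages/1985-cmp99-background-propagators/…-p016-x2.png`, `…-p017-x2.png` READ AS IMAGES
by this seat (2026-08-19).  The verbatim transcription of (3.74)/(3.75) is in the header of `B9Eq375Composition`, that of the
`F_{1,k}`/(3.72)/(3.73) passage and of the `st(b)` sentence in `B9Eq372Locality` — both imported BY NAME.

HONEST FRAMING (cell charter, verbatim in substance).  The cell audits Bałaban's papers; discharging its end statements would
make Bałaban's ultraviolet stability theorem unconditional inside this package — a constructive-QFT statement; it is NOT the
continuum limit and NOT the Clay problem.  THIS FILE DISCHARGES NOTHING of the series: it is finite bookkeeping — which lattice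
letters enter the closed forms of `B9Eq375Composition`, a truncation argument, one re-run of a seven-term triangle inequality, and
one explicit two-by-two computation on `ℤ²` — on the lineage's lattice carrier (`B9Eq39Adjoint`: `R W X = WXW⁻¹`, `covD`,
`covDstar`, `prodCfg U η A = (b ↦ e^{iηA(b)}·U(b))`), consuming BY NAME `B9Eq375Composition` (`tBracket₂`, `sBracket₂`, `fRem₂`, `F₂op`,
`V₂op`, `gradDiv`, `tBracket₂_eq_sBracket₂`, `gradDiv_prodCfg`, `norm_fRem₂_le`, `norm_sBracket₂_le`'s letter bounds), `B9Eq372Locality`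
(`pBonds`, `dirBonds`, `stBonds` = the bonds of the print's `st(b)`, `mem_stBonds_of_mem`, `trunc`, `norm_trunc_le`),
`B9Eq371Composition` (`covDstar_eq_neg_R_covD`, `norm_R_le_sq`, `norm_ad_le_of_le`, `norm_Iη_smul`), `B9Eq370Expansion` (`R_fluct`,
`conjRem`), the commutator `ad` of `Beta.BackgroundVertices`, and — third import, a general lemma of the tree's `Literature/Analysis` —
`Literature.Analysis.Matrix.exp_of_mul_self_eq_zero` (`e^x = 1 + x` for `x² = 0`).  Value = kernel certificate of WHAT «local» MEANS for `F_{2,k}(A)` and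
`V₂(A)`: at the bond `b = ⟨x, x + e_μ⟩` both operators see the exponent field `A` only on `b` and on the bonds ARRIVING at `x` or at
`x + e_μ`, and the argument `A′` only on the bonds arriving at `x`, arriving at `x + e_μ` or leaving `x + e_μ` (§2) — a set which, for
`d ≥ 2` and commuting shifts, is the bond set of `st(b)` PLUS THE COLLINEAR NEIGHBOURS `b ± e_μ` (§1), and the collinear neighbour is
genuinely seen (§3: on `ℤ²` with the carrier `𝓛(ℂ²) ≅ M₂(ℂ)`, `(V₂(A)A′)(b) ≠ (V₂(A)0)(b) = 0` for an `A′` vanishing on every bond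
of `st(b)`); and that (3.72)/(3.73) hold for `F₂`, `V₂` with the SAME explicit constants as in `B9Eq375Composition` when the sups are taken
over the local letters only (§4).  NOT summit progress.

ABSOLUTE RULE.  No internally-minted statement enters as a cited fact.  Every declaration below is PROVED (tags `[folklore]`);
the `[cite: …]` tags document WHICH PRINTED CLAUSE a definition or a proved statement transcribes — the proofs are ours, the
print is not used as a hypothesis anywhere.  The regularity input (3.37) enters the two `_loc_printed` corollaries as HYPOTHESES on
the local letters (`‖A(b′)‖ ≤ a ≤ α₁(L^jη)⁻¹`, `‖(D¹A)‖ ≤ g ≤ η·α₁(L^jη)⁻²`) with `α₁`, `L ≥ 1`, `η > 0`, `j` as binders.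

LETTERS AND NORMALISATION (as `B9Eq371Composition`/`B9Eq375Composition`): `A` = exponent field of `U′ = e^{iηA}U`, `A′` = the argument;
`D¹ = covD = ηD`, `D¹* = covDstar = ηD*`; every object is `η²` × the printed one.  A BOND is a pair `(κ, z)` = `⟨z, z + e_κ⟩` (direction,
initial site); `x + e_ν = T ν x`, `x − e_ν = (T ν).symm x`; the bond `⟨x + e_μ − e_ν, x + e_μ⟩` ARRIVING at `x + e_μ` from direction `ν`
is `(ν, (T ν).symm (T μ x))`, as in the printed letter `R(U(x + ηe_μ, x + ηe_μ − ηe_ν))A′_ν(x + ηe_μ − ηe_ν)` of (3.75).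

WHAT IS IN PRINT («…» verbatim from the renders).  p. 405 [PDF 17], (3.75) (fully transcribed in `B9Eq375Composition`):
«(D_{U′U}D*_{U′U}A′)_μ(x) = (D_U D*_U A′)_μ(x) − Σ_{ν=1}^d [− iad_{A_μ(x)}R(U(x, x + ηe_μ))(D*_νA′_ν)(x + ηe_μ) + R(U(x, x + ηe_μ))
iad_{A_ν(x+ηe_μ)}(D*_νA′_ν)(x + ηe_μ) − iad_{A_ν(x)}(D*_νA′_ν)(x) + iad_{A_ν(x)}(D_μA′_ν)(x) + iad_{(D_μA_ν)(x)}R(U(x, x + ηe_μ))A′_ν(x + ηe_μ)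
+ R(U(x, x + ηe_μ))iad_{(D*_νA_ν)(x+ηe_μ)}·R(U(x + ηe_μ, x + ηe_μ − ηe_ν))A′_ν(x + ηe_μ − ηe_ν) − iad_{(D*_νA_ν)(x)}R(U(x, x − ηe_ν))A′_ν(x − ηe_ν)]
− (F_{2,k}(A)A′)_μ(x) = (DD*A′)_μ(x) − (V₂(A)A′)_μ(x), (3.75) where the operators F_{2,k}(A), V₂(A) satisfy the bounds (3.72), (3.73).»
p. 405, after (3.71): «The operator F_{1,k} is defined similarly to F′_{1,k} by taking the remainder of the expansion R(U′) = exp ηiad_A =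
1 + ηiad_A + ⋯ in the expressions above. It is a local, bounded operator satisfying the bound |(F_{1,k}(A)A′)_μ(x)| ≤ O(1)|A|²|A′| ≤
O(1)α₁²(L^jη)⁻²|A′|, b ∈ Ω_j (3.72) with the same norms |A|, |A′| determined by the set st(b) as in (3.69). The operator V₁ satisfies
|(V₁(A)A′)(b)| ≤ O(1)(|A||∇A′| + |∇A||A′| + |A|²|A′|) ≤ O(1)α₁((L^jη)⁻¹|∇A′| + (L^jη)⁻²|A′|), b ∈ Ω_j, (3.73) with the same conditions on
norms as above. The derivatives are, of course, the covariant derivatives defined by U. The constant O(1) is an absolute constant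
depending on d only.»  p. 404 [PDF 16], after (3.69): «the supremum on the right-hand side is taken over bonds belonging to one of the
plaquettes containing the bond b (i.e. we have max_{b′:b′⊂∂p,p∈st(b)}|A′(b′)|, where st(b) = {plaquettes p : b ⊂ ∂p and orientation of
∂p agrees with that of b}).»  (3.39), p. 397: «|A| = max_μ sup_x |A_μ(x)|, |∇A| = max_{μ,ν} sup_x |(D_μA_ν)(x)|»; (3.37), p. 396:
«|A′| < α₁(L^jη)⁻¹, |∇^η_U A′| < α₁(L^jη)⁻² on Ω_j, j = 0, …, k;».  READING (fixed in `B9Eq375Composition` by the last equality of (3.75)):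
`(V₂(A)A′)_μ(x) = Σ_ν[seven-term bracket]_ν + (F_{2,k}(A)A′)_μ(x)`; the sentence «satisfy the bounds (3.72), (3.73)» transfers to `F_{2,k}`,
`V₂` the two displayed inequalities AND their norm clause «with the same norms |A|, |A′| determined by the set st(b)».  THE FINDING OF
THIS FILE (cell DIVERGENCE D-pv27.12, a wording imprecision, immaterial for the estimates): for `V₂` — a perturbation of the bond
LAPLACIAN `DD*`, not of the plaquette operator `DRD*` of (3.71) — the letters at `b` are NOT confined to the plaquettes of `st(b)`: the
`ν = μ` summand of (3.75) does not vanish (contrast `B9Eq372Locality.sBracket_self`, `fRem_self` for (3.71)) and carries the collinear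
bonds `b − e_μ = ⟨x − e_μ, x⟩`, `b + e_μ = ⟨x + e_μ, x + 2e_μ⟩`, which lie on no plaquette through `b` (`forward_not_mem_stBonds`); the
correct reading of «local» for (3.75) is «determined by the letters on the bonds incident to the endpoints of `b`» (`locBonds₂_eq`), and
with THAT set both printed inequalities hold verbatim (§4).  A by-product of the kernel check (`tBracket₂_congr`): the letters `A_ν(x)`,
`A_ν(x + e_μ)`, `A′_ν(x)` displayed in the second to fifth terms of the bracket CANCEL — the bracket, and the whole of `(V₂(A)A′)_μ(x)`,
do not depend on them (`dirBondsA`, `dirBondsA'`).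

WHAT THIS FILE PROVES.  MODEL (as in the lineage leaves): `𝔸` a complete normed ℂ-algebra; sites `S`, directions `ι` (`Fintype` where
`Σ_ν` occurs), shifts `T ν : S ≃ S` (NO commutation assumed except where stated as a hypothesis `hT`), background `U : ι → S → 𝔸ˣ`
(ARBITRARY units), `A`, `A′ : ι → S → 𝔸`; norms = the `NormedRing` norm.
* §1 SETS at `b = (μ, x)`: **`dirBonds₂ T ν μ x`** `= {(μ,x), (ν,x), (ν,x+e_μ), (ν,x−e_ν), (ν,x+e_μ−e_ν)}` — `b` and the `ν`-bonds at its
  endpoints = the letters DISPLAYED in the direction-`ν` summand of (3.75); **`locBonds₂ T μ x = ⋃_ν dirBonds₂`**, **`locBonds₂_eq`**: `=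
  siteStar x ∪ siteStar (x + e_μ)` (the bonds incident to the endpoints of `b`); the finer DEPENDENCE SETS **`dirBondsA`** `= {(μ,x),
  (ν,x−e_ν), (ν,x+e_μ−e_ν)}` (for `A`) and **`dirBondsA'`** `= {(ν,x+e_μ), (ν,x−e_ν), (ν,x+e_μ−e_ν)}` (for `A′`), their unions `locBondsA`
  (`locBondsA_eq`: the bonds ARRIVING at `x` or at `x + e_μ` — `b` is one of them) and `locBondsA'` (`locBondsA'_eq`: those, plus the bonds
  LEAVING `x + e_μ`), all inside `locBonds₂`; `dirGrads₂`/`locGrads₂` (the index triples `(κ, τ, z)` of the forward differences entering,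
  `letters_of_mem_dirGrads₂`: both letters in `dirBonds₂`); the degenerate direction is NOT degenerate: **`dirBonds₂_self`** `= {b − e_μ, b,
  b + e_μ}`; PLACEMENT: **`locBonds₂_subset_stBonds_union`** — if the shifts commute at `x` (`hT`), `locBonds₂(b) ⊆ stBonds(b) ∪ {b − e_μ,
  b, b + e_μ}` (`dirBonds₂_subset_dirBonds`: for `ν ≠ μ` the five letters lie on the two plaquettes of `st(b)` in the `(ν, μ)`-plane).
* §2 LOCALITY («It is a local … operator», for (3.75)): **`tBracket₂_congr`**, **`sBracket₂_congr`**, **`fRem₂_congr`** — if `A, B` agree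
  on `dirBondsA T ν μ x` and `A′, B′` agree on `dirBondsA' T ν μ x`, the direction-`ν` summands (first order, all orders) agree; hence
  **`F₂op_congr`**, `sum_sBracket₂_congr`, **`V₂op_congr`** (agreement of `A` on `locBondsA(b)` and of `A′` on `locBondsA'(b)` ⟹ the same
  `(F₂(A)A′)(b)`, `(V₂(A)A′)(b)`), the coarser **`V₂op_congr_loc`** (agreement on `locBonds₂(b)`), and **`V₂op_congr_st_collinear`** (on
  commuting shifts: agreement on `stBonds(b) ∪ {b − e_μ, b, b + e_μ}` suffices); `sBracket₂_zero_right`, `fRem₂_zero_right`,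
  `V₂op_zero_right` (`V₂(A)0 = 0`).
* §3 THE WITNESS (`S = ℤ²`, `ι = Fin 2`, shifts `T₂` = the unit translations — they commute, `T₂_comm` — background `U₁ ≡ 1`, `b = ⟨(0,0),
  (1,0)⟩`, exponent field `A = a·δ_b`, argument `A′ = Y·δ_{b+e_μ}`, which vanishes on `stBonds(b)`: `forward_not_mem_stBonds`,
  `δ_forward_agree`): **`sum_sBracket₂_witness`** `Σ_ν sBracket₂_ν = iη[a, Y]`; **`V₂op_witness`** `(V₂(A)A′)(b) = e^{iηa}Ye^{−iηa} − Y`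
  (from (3.75) itself, `gradDiv_prodCfg`, and the two Laplacians `gradDiv_witness = −Y`, `gradDiv_prodCfg_witness = −e^{iηa}Ye^{−iηa}`);
  hence **`sum_sBracket₂_not_stLocal`** (any carrier with `aY ≠ Ya`, `η ≠ 0`) and **`V₂op_not_stLocal`** (any carrier with `e^{iηa}Ye^{−iηa}
  ≠ Y`): the `st(b)`-shaped locality statements of `B9Eq372Locality.sum_sBracket_congr_st` / `V₁op_congr_st` FAIL for the bracket of
  (3.75) / for `V₂`; `exp_conj_ne_of_mul_self_eq_zero` (from `Literature.Analysis.Matrix.exp_of_mul_self_eq_zero`, `e^x = 1 + x` for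
  `x² = 0`, imported BY NAME); and UNCONDITIONALLY on the carrier `𝓛(ℂ²) = (Fin 2 → ℂ) →L[ℂ] (Fin 2 → ℂ)` (`≅ M₂(ℂ)`, library instances;
  `a = opE₀₁`, `Y = opE₁₀`, `opE₀₁_sq`, `op_noncomm`, `op_key`): **`sum_sBracket₂_not_stLocal_op`**, **`V₂op_not_stLocal_op`** (`η ≠ 0`).
* §4 THE BOUNDS WITH THE LOCAL NORMS («with the same norms |A|, |A′| determined by the set …», read with the sets of §1; transport size
  `‖U(b)‖, ‖U(b)⁻¹‖ ≤ ρ` uniform as in (3.35); `s = ηρ²a`): **`norm_fRem₂_le_loc`** (= `norm_fRem₂_le` with `‖A‖ ≤ a` on `dirBondsA`, `‖A′‖ ≤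
  a′` on `dirBondsA'` only — locality + truncation); **`norm_F₂op_le_loc`** — (3.72), first inequality: `‖(F₂(A)A′)_μ(x)‖ ≤ d·4ρ⁴s²e^{2s}(3 +
  2s + s²e^{2s})·a′` with `a`, `a′` the maxima over `locBondsA(b)`, `locBondsA'(b)`; **`norm_sBracket₂_le_loc`** (the seven-term estimate of
  `B9Eq375Composition.norm_sBracket₂_le` re-run with its twelve letter bounds on `dirBonds₂`/`dirGrads₂` only: `≤ η((4ρ⁴ + 2ρ² + 2)ag′ +
  2ρ²(1 + ρ² + ρ⁴)ga′)`), `norm_sum_sBracket₂_le_loc` (`≤ d·η(…)` on `locBonds₂`/`locGrads₂`), **`norm_V₂op_le_loc`** — (3.73), first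
  inequality, all three printed terms, every sup on `locBonds₂(b)`/`locGrads₂(b)`; at the PRINTED SCALE (`ρ = 1`, (3.37) on the local
  letters only; the real-arithmetic steps isolated as `scaleF_le`, `scaleB_le`): **`norm_F₂op_le_loc_printed`** `≤ d·4e^{2α₁}(3 + 2α₁ +
  α₁²e^{2α₁})·α₁²·L^{−2j}·a′` — (3.72), second inequality; **`norm_V₂op_le_loc_printed`** `≤ d·α₁·[8L^{−j}g′ + (6 + 4α₁e^{2α₁}(3 + 2α₁ +
  α₁²e^{2α₁}))L^{−2j}a′]` — (3.73), second inequality (×`η²`; the factor `d`, not `d − 1`: the `ν = μ` summand survives).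
* §5 SANITY (`example`s): an argument vanishing on `locBondsA'(b)` gives `(V₂(A)A′)(b) = 0`; on `ℤ²` the placement hypothesis `hT` holds
  and `locBonds₂(b) ⊆ stBonds(b) ∪ {b − e_μ, b, b + e_μ}`; the witness at `η = 0` is `0`.

RELATED IN THE TREE, NOT DUPLICATED (searched 2026-08-19: MODULE-MAP rows B9/B12/Beta; `grep -rn "stBonds\|locBonds\|dirBonds\|(3.75)"
Balaban1983to89/`): `B9Eq372Locality` is the same clause for `F_{1,k}`, `V₁` of (3.71), where `st(b)` IS the right set (`sBracket_self`:
the `ν = μ` summands vanish) — its sets and truncation tool are used BY NAME, nothing restated; `B9Eq375Composition` proves (3.75) and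
(3.72)/(3.73) for `F₂`, `V₂` with UNIFORM sups and lists the locality clause as NOT PROVED — this file is exactly that clause;
`B9Eq369Small`/`B9Eq369Product` treat (3.69) (`Δ′`, plaquette-local).  Nothing in the tree types the dependence set of (3.75) or proves a
non-locality witness for `V₂`.

NOT PROVED HERE, NOT CLAIMED: the domain geometry `b ∈ Ω_j` and the scale map `j(b)` (the scale-`j` constants are binders); «bounded
operator» as an operator-norm statement on a space of configurations (typed pointwise at each `b`); NECESSITY of every listed letter
(only sufficiency of `dirBondsA`/`dirBondsA'` is proved, plus the necessity of the collinear letter `A′(b + e_μ)` by the witness);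
(3.76)/(3.68) (`P(U′U)`, `P′(A)`, `P₁(A)`) and after; any statement in the normalised Hilbert–Schmidt norm of p. 392 (cell DIVERGENCE
D-1).  Records: GAPS C-pv27-76, DIVERGENCE D-pv27.12 (the `st(b)` wording for `V₂`: imprecise by the collinear neighbours of `b`,
immaterial; modelling divergences as in D-pv27.10).  NOT summit progress.
-/

noncomputable section

namespace Literature.MathematicalPhysics.QuantumFieldTheory.Balaban1983to89.B9Eq375Locality

open NormedSpace Complex
open Literature.MathematicalPhysics.QuantumFieldTheory.Balaban1983to89
open Literature.MathematicalPhysics.QuantumFieldTheory.Balaban1983to89.Beta.TransportVertices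
open Literature.MathematicalPhysics.QuantumFieldTheory.Balaban1983to89.Beta.BackgroundVertices
  (ad ad_apply norm_ad_le ad_add_left ad_add_right ad_sub_left ad_sub_right ad_neg_left ad_smul_left)
open Literature.MathematicalPhysics.QuantumFieldTheory.Balaban1983to89.B9Eq37Insertion
open Literature.MathematicalPhysics.QuantumFieldTheory.Balaban1983to89.B9Eq39Adjoint
open Literature.MathematicalPhysics.QuantumFieldTheory.Balaban1983to89.B9Eq369Product
open Literature.MathematicalPhysics.QuantumFieldTheory.Balaban1983to89.B9Eq370Expansion
open Literature.MathematicalPhysics.QuantumFieldTheory.Balaban1983to89.B9Eq371Composition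
open Literature.MathematicalPhysics.QuantumFieldTheory.Balaban1983to89.B9Eq372Locality
open Literature.MathematicalPhysics.QuantumFieldTheory.Balaban1983to89.B9Eq375Composition
open Literature.Analysis.Matrix (exp_of_mul_self_eq_zero)

/-! ## §1  The letter sets of (3.75) at `b = ⟨x, x + e_μ⟩` -/

section Sets

variable {S : Type*} {ι : Type*} (T : ι → Equiv.Perm S)

/-- THE LETTERS DISPLAYED IN THE DIRECTION-`ν` SUMMAND OF (3.75) at `b = (μ, x)`: `b` itself and the four `ν`-bonds at the endpoints
`x`, `x + e_μ` of `b` — leaving them, `(ν, x)`, `(ν, x+e_μ)`, and arriving at them, `(ν, x−e_ν)`, `(ν, x+e_μ−e_ν)`.  For `ν = μ` these are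
the three COLLINEAR bonds `b − e_μ, b, b + e_μ` (`dirBonds₂_self`). [folklore] [cite: Balaban1985BackgroundPropagators, (3.75) p.405] -/
def dirBonds₂ (ν μ : ι) (x : S) : Set (ι × S) :=
  {(μ, x), (ν, x), (ν, T μ x), (ν, (T ν).symm x), (ν, (T ν).symm (T μ x))}

/-- **THE LOCALITY SET OF (3.75) AT `b`**: the union over ALL directions `ν` — the bonds incident to the endpoints of `b` (`locBonds₂_eq`).
[folklore] [cite: Balaban1985BackgroundPropagators, (3.75) p.405, (3.72)–(3.73) p.405] -/
def locBonds₂ (μ : ι) (x : S) : Set (ι × S) := ⋃ ν, dirBonds₂ T ν μ x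

/-- THE DEPENDENCE SET OF THE EXPONENT FIELD `A`, direction `ν`: `A_μ(x)` (through `R(U′(b))`) and `A_ν(x−e_ν)`, `A_ν(x+e_μ−e_ν)`
(through `U′` on the bonds arriving at the endpoints, inside `D*_{U′}`); the displayed `A_ν(x)`, `A_ν(x+e_μ)` cancel (`tBracket₂_congr`).
[folklore] [cite: Balaban1985BackgroundPropagators, (3.75) p.405] -/
def dirBondsA (ν μ : ι) (x : S) : Set (ι × S) := {(μ, x), (ν, (T ν).symm x), (ν, (T ν).symm (T μ x))}

/-- THE DEPENDENCE SET OF THE ARGUMENT `A′`, direction `ν`: `A′_ν(x+e_μ)`, `A′_ν(x−e_ν)`, `A′_ν(x+e_μ−e_ν)`; the displayed `A′_ν(x)`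
(third and fourth terms of the bracket) cancels (`tBracket₂_congr`). [folklore] [cite: Balaban1985BackgroundPropagators, (3.75) p.405] -/
def dirBondsA' (ν μ : ι) (x : S) : Set (ι × S) := {(ν, T μ x), (ν, (T ν).symm x), (ν, (T ν).symm (T μ x))}

/-- … its union over `ν`: the bonds ARRIVING at `x` or at `x + e_μ` (`locBondsA_eq`; `b` arrives at `x + e_μ`). [folklore] -/
def locBondsA (μ : ι) (x : S) : Set (ι × S) := ⋃ ν, dirBondsA T ν μ x

/-- … and for the argument: the bonds arriving at `x`, and all bonds at `x + e_μ` (`locBondsA'_eq`). [folklore] -/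
def locBondsA' (μ : ι) (x : S) : Set (ι × S) := ⋃ ν, dirBondsA' T ν μ x

/-- The index triples `(κ, τ, z)` of the FORWARD covariant differences `(D¹_κA_τ)(z)`, `(D¹_κA′_τ)(z)` entering the bracket of direction
`ν` (its `D*`-letters rewritten `(D¹*_νX_ν)(z) = −R(U_ν(z−e_ν))⁻¹(D¹_νX_ν)(z−e_ν)`, `B9Eq371Composition.covDstar_eq_neg_R_covD`):
`(D¹_νX_ν)(x+e_μ−e_ν)`, `(D¹_νX_ν)(x−e_ν)`, `(D¹_μX_ν)(x)`. [folklore] [cite: Balaban1985BackgroundPropagators, (3.75) p.405, (3.39) p.397] -/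
def dirGrads₂ (ν μ : ι) (x : S) : Set (ι × ι × S) := {(ν, ν, (T ν).symm (T μ x)), (ν, ν, (T ν).symm x), (μ, ν, x)}

/-- … and their union over all `ν`. [folklore] [cite: Balaban1985BackgroundPropagators, (3.73) p.405] -/
def locGrads₂ (μ : ι) (x : S) : Set (ι × ι × S) := ⋃ ν, dirGrads₂ T ν μ x

/-- The bonds incident to the site `y`: leaving it, `⟨y, y + e_ν⟩ = (ν, y)`, and arriving at it, `⟨y − e_ν, y⟩ = (ν, (T ν)⁻¹ y)`. [folklore] -/
def siteStar (y : S) : Set (ι × S) := ⋃ ν, {(ν, y), (ν, (T ν).symm y)}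

/-- The bonds arriving at the site `y`. [folklore] -/
def inStar (y : S) : Set (ι × S) := ⋃ ν, {(ν, (T ν).symm y)}

variable {T}

/-- The letters of direction `ν` lie in the locality set. [folklore] -/
theorem mem_locBonds₂_of_mem {ν μ : ι} {x : S} {q : ι × S} (h : q ∈ dirBonds₂ T ν μ x) : q ∈ locBonds₂ T μ x :=
  Set.mem_iUnion.mpr ⟨ν, h⟩

/-- … and the same for the two dependence sets … [folklore] -/
theorem mem_locBondsA_of_mem {ν μ : ι} {x : S} {q : ι × S} (h : q ∈ dirBondsA T ν μ x) : q ∈ locBondsA T μ x :=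
  Set.mem_iUnion.mpr ⟨ν, h⟩

/-- … for `A` and for `A′`. [folklore] -/
theorem mem_locBondsA'_of_mem {ν μ : ι} {x : S} {q : ι × S} (h : q ∈ dirBondsA' T ν μ x) : q ∈ locBondsA' T μ x :=
  Set.mem_iUnion.mpr ⟨ν, h⟩

/-- … and for the gradient triples. [folklore] -/
theorem mem_locGrads₂_of_mem {ν μ : ι} {x : S} {q : ι × ι × S} (h : q ∈ dirGrads₂ T ν μ x) : q ∈ locGrads₂ T μ x :=
  Set.mem_iUnion.mpr ⟨ν, h⟩

/-- The dependence set of `A` lies inside the displayed letters … [folklore] -/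
theorem dirBondsA_subset (ν μ : ι) (x : S) : dirBondsA T ν μ x ⊆ dirBonds₂ T ν μ x := by
  intro q hq
  simp only [dirBondsA, Set.mem_insert_iff, Set.mem_singleton_iff] at hq
  rcases hq with rfl | rfl | rfl <;> simp [dirBonds₂]

/-- … and so does that of `A′`. [folklore] -/
theorem dirBondsA'_subset (ν μ : ι) (x : S) : dirBondsA' T ν μ x ⊆ dirBonds₂ T ν μ x := by
  intro q hq
  simp only [dirBondsA', Set.mem_insert_iff, Set.mem_singleton_iff] at hq
  rcases hq with rfl | rfl | rfl <;> simp [dirBonds₂]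

/-- The dependence set of `A` at `b` lies inside the locality set … [folklore] -/
theorem locBondsA_subset (μ : ι) (x : S) : locBondsA T μ x ⊆ locBonds₂ T μ x := fun _ hq => by
  obtain ⟨ν, h⟩ := Set.mem_iUnion.mp hq
  exact mem_locBonds₂_of_mem (dirBondsA_subset ν μ x h)

/-- … and so does that of `A′`. [folklore] -/
theorem locBondsA'_subset (μ : ι) (x : S) : locBondsA' T μ x ⊆ locBonds₂ T μ x := fun _ hq => by
  obtain ⟨ν, h⟩ := Set.mem_iUnion.mp hq
  exact mem_locBonds₂_of_mem (dirBondsA'_subset ν μ x h)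

/-- `b` is a displayed letter of every direction, … [folklore] -/
theorem base_mem_dirBonds₂ (ν μ : ι) (x : S) : (μ, x) ∈ dirBonds₂ T ν μ x := by
  simp [dirBonds₂]

/-- … a letter of `A` of every direction, … [folklore] -/
theorem base_mem_dirBondsA (ν μ : ι) (x : S) : (μ, x) ∈ dirBondsA T ν μ x := by
  simp [dirBondsA]

/-- … and a letter of `A′` of direction `μ`. [folklore] -/
theorem base_mem_dirBondsA'_self (μ : ι) (x : S) : (μ, x) ∈ dirBondsA' T μ μ x := by
  simp [dirBondsA']

/-- `b` lies in its locality set. [folklore] -/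
theorem base_mem_locBonds₂ (μ : ι) (x : S) : (μ, x) ∈ locBonds₂ T μ x :=
  mem_locBonds₂_of_mem (base_mem_dirBonds₂ μ μ x)

/-- `b + e_μ` is a displayed letter of direction `μ`. [folklore] -/
theorem forward_mem_dirBonds₂ (μ : ι) (x : S) : (μ, T μ x) ∈ dirBonds₂ T μ μ x := by
  simp [dirBonds₂]

/-- Both letters `(τ, z + e_κ)`, `(τ, z)` of every gradient triple `(κ, τ, z) ∈ dirGrads₂` are displayed letters. [folklore]
[cite: Balaban1985BackgroundPropagators, (3.3) p.391] -/
theorem letters_of_mem_dirGrads₂ {ν μ κ τ : ι} {x z : S} (h : (κ, τ, z) ∈ dirGrads₂ T ν μ x) :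
    (τ, T κ z) ∈ dirBonds₂ T ν μ x ∧ (τ, z) ∈ dirBonds₂ T ν μ x := by
  simp only [dirGrads₂, Set.mem_insert_iff, Set.mem_singleton_iff, Prod.mk.injEq] at h
  rcases h with ⟨rfl, rfl, rfl⟩ | ⟨rfl, rfl, rfl⟩ | ⟨rfl, rfl, rfl⟩ <;> simp [dirBonds₂]

/-- … hence both letters of every triple of `locGrads₂(b)` lie in `locBonds₂(b)`. [folklore] -/
theorem letters_of_mem_locGrads₂ {μ κ τ : ι} {x z : S} (h : (κ, τ, z) ∈ locGrads₂ T μ x) :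
    (τ, T κ z) ∈ locBonds₂ T μ x ∧ (τ, z) ∈ locBonds₂ T μ x := by
  obtain ⟨ν, hq⟩ := Set.mem_iUnion.mp h
  obtain ⟨h₁, h₂⟩ := letters_of_mem_dirGrads₂ hq
  exact ⟨mem_locBonds₂_of_mem h₁, mem_locBonds₂_of_mem h₂⟩

/-- THE DEGENERATE DIRECTION IS NOT DEGENERATE HERE: the displayed letters of direction `μ` are the three collinear bonds `b − e_μ`, `b`,
`b + e_μ` (contrast `B9Eq372Locality.sBracket_self` for (3.71)). [folklore] [cite: Balaban1985BackgroundPropagators, (3.75) p.405] -/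
theorem dirBonds₂_self (μ : ι) (x : S) : dirBonds₂ T μ μ x = {(μ, (T μ).symm x), (μ, x), (μ, T μ x)} := by
  ext q
  simp only [dirBonds₂, Equiv.symm_apply_apply, Set.mem_insert_iff, Set.mem_singleton_iff]
  tauto

/-- … of which `A` is seen on `b` and `b − e_μ` … [folklore] -/
theorem dirBondsA_self (μ : ι) (x : S) : dirBondsA T μ μ x = {(μ, x), (μ, (T μ).symm x)} := by
  ext q
  simp only [dirBondsA, Equiv.symm_apply_apply, Set.mem_insert_iff, Set.mem_singleton_iff]
  tauto

/-- … and `A′` on all three. [folklore] -/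
theorem dirBondsA'_self (μ : ι) (x : S) : dirBondsA' T μ μ x = {(μ, T μ x), (μ, (T μ).symm x), (μ, x)} := by
  ext q
  simp only [dirBondsA', Equiv.symm_apply_apply, Set.mem_insert_iff, Set.mem_singleton_iff]

/-- **`locBonds₂(b)` = THE BONDS INCIDENT TO `x` OR TO `x + e_μ`.** [folklore] [cite: Balaban1985BackgroundPropagators, (3.75) p.405] -/
theorem locBonds₂_eq (μ : ι) (x : S) : locBonds₂ T μ x = siteStar T x ∪ siteStar T (T μ x) := by
  ext q
  simp only [locBonds₂, dirBonds₂, siteStar, Set.mem_iUnion, Set.mem_union, Set.mem_insert_iff, Set.mem_singleton_iff]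
  constructor
  · rintro ⟨ν, h | h | h | h | h⟩
    · exact Or.inl ⟨μ, Or.inl h⟩
    · exact Or.inl ⟨ν, Or.inl h⟩
    · exact Or.inr ⟨ν, Or.inl h⟩
    · exact Or.inl ⟨ν, Or.inr h⟩
    · exact Or.inr ⟨ν, Or.inr h⟩
  · rintro (⟨ν, h | h⟩ | ⟨ν, h | h⟩)
    · exact ⟨ν, Or.inr (Or.inl h)⟩
    · exact ⟨ν, Or.inr (Or.inr (Or.inr (Or.inl h)))⟩
    · exact ⟨ν, Or.inr (Or.inr (Or.inl h))⟩
    · exact ⟨ν, Or.inr (Or.inr (Or.inr (Or.inr h)))⟩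

/-- **`(V₂(A)A′)(b)` SEES `A` EXACTLY ON THE BONDS ARRIVING AT `x` OR AT `x + e_μ`** (sufficiency: `V₂op_congr`). [folklore]
[cite: Balaban1985BackgroundPropagators, (3.75) p.405] -/
theorem locBondsA_eq (μ : ι) (x : S) : locBondsA T μ x = inStar T x ∪ inStar T (T μ x) := by
  ext q
  simp only [locBondsA, dirBondsA, inStar, Set.mem_iUnion, Set.mem_union, Set.mem_insert_iff, Set.mem_singleton_iff]
  constructor
  · rintro ⟨ν, h | h | h⟩
    · exact Or.inr ⟨μ, by rw [h, Equiv.symm_apply_apply]⟩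
    · exact Or.inl ⟨ν, h⟩
    · exact Or.inr ⟨ν, h⟩
  · rintro (⟨ν, h⟩ | ⟨ν, h⟩)
    · exact ⟨ν, Or.inr (Or.inl h)⟩
    · exact ⟨ν, Or.inr (Or.inr h)⟩

/-- **… AND `A′` ON THOSE PLUS THE BONDS LEAVING `x + e_μ`** — not on the bonds leaving `x` other than `b`. [folklore]
[cite: Balaban1985BackgroundPropagators, (3.75) p.405] -/
theorem locBondsA'_eq (μ : ι) (x : S) : locBondsA' T μ x = inStar T x ∪ siteStar T (T μ x) := by
  ext q
  simp only [locBondsA', dirBondsA', inStar, siteStar, Set.mem_iUnion, Set.mem_union, Set.mem_insert_iff, Set.mem_singleton_iff]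
  constructor
  · rintro ⟨ν, h | h | h⟩
    · exact Or.inr ⟨ν, Or.inl h⟩
    · exact Or.inl ⟨ν, h⟩
    · exact Or.inr ⟨ν, Or.inr h⟩
  · rintro (⟨ν, h⟩ | ⟨ν, h | h⟩)
    · exact ⟨ν, Or.inr (Or.inl h)⟩
    · exact ⟨ν, Or.inl h⟩
    · exact ⟨ν, Or.inr (Or.inr h)⟩

/-- PLACEMENT AGAINST `st(b)`, ONE TRANSVERSE DIRECTION: if the shifts `T ν`, `T μ` commute at `x` (as on `T_η`), the displayed letters of
direction `ν ≠ μ` lie on the two plaquettes of `st(b)` in the `(ν, μ)`-plane (`B9Eq372Locality.dirBonds`). [folklore]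
[cite: Balaban1985BackgroundPropagators, p.404 after (3.69), (3.75) p.405] -/
theorem dirBonds₂_subset_dirBonds {ν μ : ι} {x : S} (hT : (T ν).symm (T μ x) = T μ ((T ν).symm x)) :
    dirBonds₂ T ν μ x ⊆ dirBonds T ν μ x := by
  intro q hq
  simp only [dirBonds₂, Set.mem_insert_iff, Set.mem_singleton_iff] at hq
  rcases hq with rfl | rfl | rfl | rfl | rfl <;> simp [dirBonds, pBonds, hT]

/-- **PLACEMENT AGAINST `st(b)`**: on commuting shifts the locality set of (3.75) at `b` is contained in the bonds of `st(b)` PLUS THE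
THREE COLLINEAR BONDS `b − e_μ, b, b + e_μ` — and the collinear neighbours are genuinely needed (§3). [folklore]
[cite: Balaban1985BackgroundPropagators, p.404 after (3.69), (3.72)–(3.73) p.405, (3.75) p.405] -/
theorem locBonds₂_subset_stBonds_union {μ : ι} {x : S} (hT : ∀ ν, (T ν).symm (T μ x) = T μ ((T ν).symm x)) :
    locBonds₂ T μ x ⊆ stBonds T μ x ∪ {(μ, (T μ).symm x), (μ, x), (μ, T μ x)} := by
  intro q hq
  obtain ⟨ν, hq⟩ := Set.mem_iUnion.mp hq
  by_cases hν : ν = μ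
  · subst hν
    rw [dirBonds₂_self] at hq
    exact Or.inr hq
  · exact Or.inl (mem_stBonds_of_mem hν (dirBonds₂_subset_dirBonds (hT ν) hq))

end Sets

/-! ## §2  LOCALITY of the summands of (3.75), of `F_{2,k}(A)A′` and of `V₂(A)A′` -/

section Locality

variable {𝔸 : Type*} [NormedRing 𝔸] [NormedAlgebra ℂ 𝔸] [CompleteSpace 𝔸] {S : Type*} {ι : Type*}
variable (T : ι → Equiv.Perm S) (U : ι → S → 𝔸ˣ)

omit [CompleteSpace 𝔸] in
/-- The three-term first-order form of direction `ν` is determined by `A` on `dirBondsA T ν μ x` and `A′` on `dirBondsA' T ν μ x` (three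
letters each). [folklore] [cite: Balaban1985BackgroundPropagators, (3.75) p.405] -/
theorem tBracket₂_congr (η : ℝ) {A B A' B' : ι → S → 𝔸} {ν μ : ι} {x : S}
    (hA : ∀ κ z, (κ, z) ∈ dirBondsA T ν μ x → A κ z = B κ z) (hA' : ∀ κ z, (κ, z) ∈ dirBondsA' T ν μ x → A' κ z = B' κ z) :
    tBracket₂ T U η A A' ν μ x = tBracket₂ T U η B B' ν μ x := by
  have h1 : A μ x = B μ x := hA _ _ (by simp [dirBondsA])
  have h2 : A ν ((T ν).symm (T μ x)) = B ν ((T ν).symm (T μ x)) := hA _ _ (by simp [dirBondsA])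
  have h3 : A ν ((T ν).symm x) = B ν ((T ν).symm x) := hA _ _ (by simp [dirBondsA])
  have h4 : A' ν ((T ν).symm (T μ x)) = B' ν ((T ν).symm (T μ x)) := hA' _ _ (by simp [dirBondsA'])
  have h5 : A' ν (T μ x) = B' ν (T μ x) := hA' _ _ (by simp [dirBondsA'])
  have h6 : A' ν ((T ν).symm x) = B' ν ((T ν).symm x) := hA' _ _ (by simp [dirBondsA'])
  simp only [tBracket₂, covDstar, h1, h2, h3, h4, h5, h6]

omit [CompleteSpace 𝔸] in
/-- **LOCALITY OF THE SEVEN-TERM BRACKET**: the summand of direction `ν` of the first-order part of `(V₂(A)A′)_μ(x)` is determined by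
`A_μ(x), A_ν(x−e_ν), A_ν(x+e_μ−e_ν)` and `A′_ν(x+e_μ), A′_ν(x−e_ν), A′_ν(x+e_μ−e_ν)` — the displayed `A_ν(x)`, `A_ν(x+e_μ)`, `A′_ν(x)`
cancel (via `tBracket₂_eq_sBracket₂`). [folklore] [cite: Balaban1985BackgroundPropagators, (3.75) p.405, (3.73) p.405] -/
theorem sBracket₂_congr (η : ℝ) {A B A' B' : ι → S → 𝔸} {ν μ : ι} {x : S}
    (hA : ∀ κ z, (κ, z) ∈ dirBondsA T ν μ x → A κ z = B κ z) (hA' : ∀ κ z, (κ, z) ∈ dirBondsA' T ν μ x → A' κ z = B' κ z) :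
    sBracket₂ T U η A A' ν μ x = sBracket₂ T U η B B' ν μ x := by
  rw [← tBracket₂_eq_sBracket₂, ← tBracket₂_eq_sBracket₂, tBracket₂_congr T U η hA hA']

/-- **LOCALITY OF THE HIGHER-ORDER TERMS** («It is a local … operator», for `F_{2,k}`): `fRem₂_ν(x)` is determined by the same six
letters. [folklore] [cite: Balaban1985BackgroundPropagators, (3.72) p.405, (3.75) p.405] -/
theorem fRem₂_congr (η : ℝ) {A B A' B' : ι → S → 𝔸} {ν μ : ι} {x : S}
    (hA : ∀ κ z, (κ, z) ∈ dirBondsA T ν μ x → A κ z = B κ z) (hA' : ∀ κ z, (κ, z) ∈ dirBondsA' T ν μ x → A' κ z = B' κ z) :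
    fRem₂ T U η A A' ν μ x = fRem₂ T U η B B' ν μ x := by
  have h1 : A μ x = B μ x := hA _ _ (by simp [dirBondsA])
  have h2 : A ν ((T ν).symm (T μ x)) = B ν ((T ν).symm (T μ x)) := hA _ _ (by simp [dirBondsA])
  have h3 : A ν ((T ν).symm x) = B ν ((T ν).symm x) := hA _ _ (by simp [dirBondsA])
  have h4 : A' ν ((T ν).symm (T μ x)) = B' ν ((T ν).symm (T μ x)) := hA' _ _ (by simp [dirBondsA'])
  have h5 : A' ν (T μ x) = B' ν (T μ x) := hA' _ _ (by simp [dirBondsA'])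
  have h6 : A' ν ((T ν).symm x) = B' ν ((T ν).symm x) := hA' _ _ (by simp [dirBondsA'])
  simp only [fRem₂, divE₁, divE₂, covD, covDstar, prodCfg, fluct, h1, h2, h3, h4, h5, h6]

/-- **`F_{2,k}(A)` IS LOCAL**: exponent fields agreeing on `locBondsA(b)` and arguments agreeing on `locBondsA'(b)` give the same
`(F₂(A)A′)_μ(x)`. [folklore] [cite: Balaban1985BackgroundPropagators, (3.72) p.405, (3.75) p.405] -/
theorem F₂op_congr [Fintype ι] (η : ℝ) {A B A' B' : ι → S → 𝔸} {μ : ι} {x : S}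
    (hA : ∀ κ z, (κ, z) ∈ locBondsA T μ x → A κ z = B κ z) (hA' : ∀ κ z, (κ, z) ∈ locBondsA' T μ x → A' κ z = B' κ z) :
    F₂op T U η A A' μ x = F₂op T U η B B' μ x := by
  unfold F₂op
  congr 1
  exact Finset.sum_congr rfl fun ν _ =>
    fRem₂_congr T U η (fun κ z h => hA κ z (mem_locBondsA_of_mem h)) (fun κ z h => hA' κ z (mem_locBondsA'_of_mem h))

omit [CompleteSpace 𝔸] in
/-- The first-order part `Σ_ν sBracket₂_ν` at `b` is determined by `A` on `locBondsA(b)` and `A′` on `locBondsA'(b)`. [folklore]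
[cite: Balaban1985BackgroundPropagators, (3.73) p.405, (3.75) p.405] -/
theorem sum_sBracket₂_congr [Fintype ι] (η : ℝ) {A B A' B' : ι → S → 𝔸} {μ : ι} {x : S}
    (hA : ∀ κ z, (κ, z) ∈ locBondsA T μ x → A κ z = B κ z) (hA' : ∀ κ z, (κ, z) ∈ locBondsA' T μ x → A' κ z = B' κ z) :
    ∑ ν, sBracket₂ T U η A A' ν μ x = ∑ ν, sBracket₂ T U η B B' ν μ x :=
  Finset.sum_congr rfl fun _ _ =>
    sBracket₂_congr T U η (fun κ z h => hA κ z (mem_locBondsA_of_mem h)) (fun κ z h => hA' κ z (mem_locBondsA'_of_mem h))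

/-- **`V₂(A)` IS LOCAL**: `(V₂(A)A′)_μ(x)` is determined by the letters of `A` on the bonds arriving at `x` or `x + e_μ` and of `A′` on
those and the bonds leaving `x + e_μ`. [folklore] [cite: Balaban1985BackgroundPropagators, (3.73) p.405, (3.75) p.405] -/
theorem V₂op_congr [Fintype ι] (η : ℝ) {A B A' B' : ι → S → 𝔸} {μ : ι} {x : S}
    (hA : ∀ κ z, (κ, z) ∈ locBondsA T μ x → A κ z = B κ z) (hA' : ∀ κ z, (κ, z) ∈ locBondsA' T μ x → A' κ z = B' κ z) :
    V₂op T U η A A' μ x = V₂op T U η B B' μ x := by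
  rw [V₂op, V₂op, sum_sBracket₂_congr T U η hA hA', F₂op_congr T U η hA hA']

/-- THE COARSE FORM: agreement of both fields on the bonds incident to the endpoints of `b` (`locBonds₂(b)`) suffices. [folklore]
[cite: Balaban1985BackgroundPropagators, (3.72)–(3.73) p.405, (3.75) p.405] -/
theorem V₂op_congr_loc [Fintype ι] (η : ℝ) {A B A' B' : ι → S → 𝔸} {μ : ι} {x : S}
    (hA : ∀ κ z, (κ, z) ∈ locBonds₂ T μ x → A κ z = B κ z) (hA' : ∀ κ z, (κ, z) ∈ locBonds₂ T μ x → A' κ z = B' κ z) :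
    V₂op T U η A A' μ x = V₂op T U η B B' μ x :=
  V₂op_congr T U η (fun κ z h => hA κ z (locBondsA_subset μ x h)) (fun κ z h => hA' κ z (locBondsA'_subset μ x h))

/-- THE REPAIRED READING OF «norms determined by the set st(b)» FOR `V₂`: on commuting shifts, agreement of the letters on the bonds of
`st(b)` AND on the collinear bonds `b − e_μ`, `b + e_μ` suffices. [folklore]
[cite: Balaban1985BackgroundPropagators, p.404 after (3.69), (3.72)–(3.73) p.405, (3.75) p.405] -/
theorem V₂op_congr_st_collinear [Fintype ι] (η : ℝ) {A B A' B' : ι → S → 𝔸} {μ : ι} {x : S}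
    (hT : ∀ ν, (T ν).symm (T μ x) = T μ ((T ν).symm x))
    (hA : ∀ κ z, (κ, z) ∈ stBonds T μ x ∪ {(μ, (T μ).symm x), (μ, x), (μ, T μ x)} → A κ z = B κ z)
    (hA' : ∀ κ z, (κ, z) ∈ stBonds T μ x ∪ {(μ, (T μ).symm x), (μ, x), (μ, T μ x)} → A' κ z = B' κ z) :
    V₂op T U η A A' μ x = V₂op T U η B B' μ x :=
  V₂op_congr_loc T U η (fun κ z h => hA κ z (locBonds₂_subset_stBonds_union hT h))
    (fun κ z h => hA' κ z (locBonds₂_subset_stBonds_union hT h))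

omit [CompleteSpace 𝔸] in
/-- No argument, no value: the bracket vanishes at `A′ = 0`, … [folklore] -/
theorem sBracket₂_zero_right (η : ℝ) (A : ι → S → 𝔸) (ν μ : ι) (x : S) : sBracket₂ T U η A 0 ν μ x = 0 := by
  simp [sBracket₂, covDstar, covD]

/-- … so do the higher-order terms, … [folklore] -/
theorem fRem₂_zero_right (η : ℝ) (A : ι → S → 𝔸) (ν μ : ι) (x : S) : fRem₂ T U η A 0 ν μ x = 0 := by
  simp [fRem₂, divE₁, divE₂, conjRem, covD, covDstar]

/-- … and `(V₂(A)0)_μ(x) = 0`. [folklore] -/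
theorem V₂op_zero_right [Fintype ι] (η : ℝ) (A : ι → S → 𝔸) (μ : ι) (x : S) : V₂op T U η A 0 μ x = 0 := by
  simp [V₂op, F₂op, sBracket₂_zero_right, fRem₂_zero_right]

end Locality

/-! ## §3  `st(b)` ALONE DOES NOT DETERMINE `(V₂(A)A′)(b)`: the witness on `ℤ²` -/

section Witness

variable {𝔸 : Type*} [NormedRing 𝔸] [NormedAlgebra ℂ 𝔸] [CompleteSpace 𝔸]

/-- The square lattice `ℤ²` with its two unit translations (`d = 2`). [folklore] -/
def T₂ : Fin 2 → Equiv.Perm (ℤ × ℤ) := ![Equiv.addRight (1, 0), Equiv.addRight (0, 1)]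

/-- The trivial background `U ≡ 1`. [folklore] -/
def U₁ : Fin 2 → ℤ × ℤ → 𝔸ˣ := fun _ _ => 1

/-- The bond field with value `X` on the bond `q` and `0` elsewhere. [folklore] -/
def δ (q : Fin 2 × (ℤ × ℤ)) (X : 𝔸) : Fin 2 → ℤ × ℤ → 𝔸 := fun κ z => if (κ, z) = q then X else 0

/-- `x + e_0 = x + (1, 0)`. [folklore] -/
@[simp] theorem T₂_zero_apply (z : ℤ × ℤ) : T₂ 0 z = z + (1, 0) := by simp [T₂]

/-- `x + e_1 = x + (0, 1)`. [folklore] -/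
@[simp] theorem T₂_one_apply (z : ℤ × ℤ) : T₂ 1 z = z + (0, 1) := by simp [T₂]

/-- `x − e_0 = x + (−1, 0)`. [folklore] -/
@[simp] theorem T₂_zero_symm_apply (z : ℤ × ℤ) : (T₂ 0).symm z = z + (-1, 0) := by simp [T₂]

/-- `x − e_1 = x + (0, −1)`. [folklore] -/
@[simp] theorem T₂_one_symm_apply (z : ℤ × ℤ) : (T₂ 1).symm z = z + (0, -1) := by simp [T₂]

omit [NormedAlgebra ℂ 𝔸] [CompleteSpace 𝔸] in
/-- `U₁ ≡ 1`. [folklore] -/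
@[simp] theorem U₁_apply (κ : Fin 2) (z : ℤ × ℤ) : (U₁ κ z : 𝔸ˣ) = 1 := rfl

omit [NormedAlgebra ℂ 𝔸] [CompleteSpace 𝔸] in
/-- The values of `δ_q X`. [folklore] -/
@[simp] theorem δ_apply (q : Fin 2 × (ℤ × ℤ)) (X : 𝔸) (κ : Fin 2) (z : ℤ × ℤ) :
    δ q X κ z = if (κ, z) = q then X else 0 := rfl

/-- The translations of `ℤ²` commute: the placement `locBonds₂_subset_stBonds_union` applies on this lattice. [folklore] -/
theorem T₂_comm (μ : Fin 2) (x : ℤ × ℤ) : ∀ ν, (T₂ ν).symm (T₂ μ x) = T₂ μ ((T₂ ν).symm x) := by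
  intro ν
  fin_cases ν <;> fin_cases μ <;> simp [add_right_comm]

/-- The bond `b + e_μ = ⟨(1,0), (2,0)⟩`, collinear with `b = ⟨(0,0), (1,0)⟩`, lies on NO plaquette through `b`: it is not a bond of
`st(b)`. [folklore] [cite: Balaban1985BackgroundPropagators, p.404 after (3.69)] -/
theorem forward_not_mem_stBonds : ((0 : Fin 2), ((1 : ℤ), (0 : ℤ))) ∉ stBonds T₂ 0 ((0 : ℤ), (0 : ℤ)) := by
  simp [stBonds, dirBonds, pBonds, Fin.exists_fin_two]

/-- … but it IS in the locality set of (3.75) (a letter of `A′`). [folklore] -/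
theorem forward_mem_locBondsA' : ((0 : Fin 2), ((1 : ℤ), (0 : ℤ))) ∈ locBondsA' T₂ 0 ((0 : ℤ), (0 : ℤ)) :=
  mem_locBondsA'_of_mem (ν := 0) (by simp [dirBondsA'])

omit [NormedAlgebra ℂ 𝔸] [CompleteSpace 𝔸] in
/-- The argument `A′ = Y·δ_{b+e_μ}` and the argument `0` AGREE on every bond of `st(b)`. [folklore] -/
theorem δ_forward_agree (Y : 𝔸) :
    ∀ κ z, (κ, z) ∈ stBonds T₂ 0 ((0 : ℤ), (0 : ℤ)) → δ (0, (1, 0)) Y κ z = (0 : Fin 2 → ℤ × ℤ → 𝔸) κ z := by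
  intro κ z h
  have hq : (κ, z) ≠ (0, (1, 0)) := fun he => forward_not_mem_stBonds (he ▸ h)
  simp [hq]

omit [CompleteSpace 𝔸] in
/-- **THE FIRST-ORDER PART AT `b` SEES THE COLLINEAR LETTER**: background `U ≡ 1`, exponent field `A = a·δ_b`, argument `A′ = Y·δ_{b+e_μ}`
(`b = ⟨(0,0),(1,0)⟩`): `Σ_ν sBracket₂_ν = iη[a, Y]` (only the first term of the `ν = μ` bracket survives: `iad_{A_μ(x)}` of the letter
`A′_μ(x + e_μ)` inside `(D*_μA′_μ)(x + e_μ)`). [folklore] [cite: Balaban1985BackgroundPropagators, (3.75) p.405] -/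
theorem sum_sBracket₂_witness (η : ℝ) (a Y : 𝔸) :
    ∑ ν, sBracket₂ T₂ U₁ η (δ (0, (0, 0)) a) (δ (0, (1, 0)) Y) ν 0 (0, 0) = ((I * η : ℂ)) • (a * Y - Y * a) := by
  simp only [← tBracket₂_eq_sBracket₂, Fin.sum_univ_two]
  simp [tBracket₂, covDstar, smul_sub]
  abel

omit [NormedAlgebra ℂ 𝔸] [CompleteSpace 𝔸] in
/-- `(D¹D¹*A′)_μ(x) = −Y` for `U ≡ 1`, `A′ = Y·δ_{b+e_μ}`. [folklore] -/
theorem gradDiv_witness (Y : 𝔸) : gradDiv T₂ U₁ (δ (0, (1, 0)) Y) 0 (0, 0) = -Y := by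
  simp [gradDiv, Fin.sum_univ_two, covD, covDstar]

/-- `(D¹_{U′}D¹*_{U′}A′)_μ(x) = −e^{iηa}Ye^{−iηa}` for `U′ = e^{iηA}·1`, `A = a·δ_b`, `A′ = Y·δ_{b+e_μ}`. [folklore] -/
theorem gradDiv_prodCfg_witness (η : ℝ) (a Y : 𝔸) :
    gradDiv T₂ (prodCfg U₁ η (δ (0, (0, 0)) a)) (δ (0, (1, 0)) Y) 0 (0, 0)
      = -(exp (((I * η : ℂ)) • a) * Y * exp (-(((I * η : ℂ)) • a))) := by
  simp [gradDiv, Fin.sum_univ_two, covD, covDstar, prodCfg, R_fluct]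

/-- **ALL ORDERS**: for the same data `(V₂(A)A′)_μ(x) = e^{iηa}Ye^{−iηa} − Y = (R(e^{iηa}) − 1)Y` — by (3.75) itself (`gradDiv_prodCfg`).
[folklore] [cite: Balaban1985BackgroundPropagators, (3.75) p.405] -/
theorem V₂op_witness (η : ℝ) (a Y : 𝔸) :
    V₂op T₂ U₁ η (δ (0, (0, 0)) a) (δ (0, (1, 0)) Y) 0 (0, 0)
      = exp (((I * η : ℂ)) • a) * Y * exp (-(((I * η : ℂ)) • a)) - Y := by
  have h := gradDiv_prodCfg T₂ U₁ η (δ (0, (0, 0)) a) (δ (0, (1, 0)) Y) 0 (0, 0)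
  rw [gradDiv_witness, gradDiv_prodCfg_witness] at h
  calc V₂op T₂ U₁ η (δ (0, (0, 0)) a) (δ (0, (1, 0)) Y) 0 (0, 0)
        = -Y - (-Y - V₂op T₂ U₁ η (δ (0, (0, 0)) a) (δ (0, (1, 0)) Y) 0 (0, 0)) := by abel
    _ = -Y - -(exp (((I * η : ℂ)) • a) * Y * exp (-(((I * η : ℂ)) • a))) := by rw [← h]
    _ = _ := by abel

omit [CompleteSpace 𝔸] in
/-- **`Σ_ν[seven-term bracket]_ν` IS NOT DETERMINED BY THE LETTERS ON `st(b)`**: whenever the carrier has `a`, `Y` with `aY ≠ Ya` and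
`η ≠ 0`, the `st(b)`-shaped locality statement of `B9Eq372Locality.sum_sBracket_congr_st` FAILS for the bracket of (3.75). [folklore]
[cite: Balaban1985BackgroundPropagators, (3.73) p.405, (3.75) p.405, p.404 after (3.69)] -/
theorem sum_sBracket₂_not_stLocal {η : ℝ} (hη : η ≠ 0) {a Y : 𝔸} (h : a * Y ≠ Y * a) :
    ¬ ∀ (A B A' B' : Fin 2 → ℤ × ℤ → 𝔸) (μ : Fin 2) (x : ℤ × ℤ),
        (∀ κ z, (κ, z) ∈ stBonds T₂ μ x → A κ z = B κ z) → (∀ κ z, (κ, z) ∈ stBonds T₂ μ x → A' κ z = B' κ z) →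
        ∑ ν, sBracket₂ T₂ U₁ η A A' ν μ x = ∑ ν, sBracket₂ T₂ U₁ η B B' ν μ x := by
  intro hloc
  have h1 := hloc (δ (0, (0, 0)) a) (δ (0, (0, 0)) a) (δ (0, (1, 0)) Y) 0 0 (0, 0) (fun _ _ _ => rfl) (δ_forward_agree Y)
  rw [sum_sBracket₂_witness] at h1
  simp only [sBracket₂_zero_right, Finset.sum_const_zero] at h1
  have hc : (I * η : ℂ) ≠ 0 := mul_ne_zero I_ne_zero (ofReal_ne_zero.mpr hη)
  exact h (sub_eq_zero.mp ((smul_eq_zero.mp h1).resolve_left hc))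

/-- **`(V₂(A)A′)(b)` IS NOT DETERMINED BY THE LETTERS ON `st(b)`** (all orders): whenever the carrier has `a`, `Y` with `e^{iηa}Ye^{−iηa} ≠
Y`, the `st(b)`-shaped locality statement of `B9Eq372Locality.V₁op_congr_st` FAILS for `V₂` — the print's «with the same norms |A|, |A′|
determined by the set st(b)», transferred verbatim from `V₁` to `V₂`, is imprecise by the collinear neighbours of `b`; the right set is
`locBondsA'` ∋ `b + e_μ` (§2, `forward_mem_locBondsA'`). [folklore]
[cite: Balaban1985BackgroundPropagators, (3.72)–(3.73) p.405, (3.75) p.405, p.404 after (3.69)] -/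
theorem V₂op_not_stLocal {η : ℝ} {a Y : 𝔸} (h : exp (((I * η : ℂ)) • a) * Y * exp (-(((I * η : ℂ)) • a)) ≠ Y) :
    ¬ ∀ (A B A' B' : Fin 2 → ℤ × ℤ → 𝔸) (μ : Fin 2) (x : ℤ × ℤ),
        (∀ κ z, (κ, z) ∈ stBonds T₂ μ x → A κ z = B κ z) → (∀ κ z, (κ, z) ∈ stBonds T₂ μ x → A' κ z = B' κ z) →
        V₂op T₂ U₁ η A A' μ x = V₂op T₂ U₁ η B B' μ x := by
  intro hloc
  have h1 := hloc (δ (0, (0, 0)) a) (δ (0, (0, 0)) a) (δ (0, (1, 0)) Y) 0 0 (0, 0) (fun _ _ _ => rfl) (δ_forward_agree Y)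
  rw [V₂op_witness, V₂op_zero_right] at h1
  exact h (sub_eq_zero.mp h1)

omit [CompleteSpace 𝔸] in
/-- For a square-zero `a` the conjugation `e^{ca}Ye^{−ca} = (1 + ca)Y(1 − ca) = Y + c[a, Y] − c²aYa` moves `Y` as soon as `[a, Y] ≠ c·aYa`
(`c ≠ 0`; `e^x = 1 + x` for `x² = 0` is `Literature.Analysis.Matrix.exp_of_mul_self_eq_zero`, used BY NAME). [folklore] -/
theorem exp_conj_ne_of_mul_self_eq_zero {c : ℂ} (hc : c ≠ 0) {a Y : 𝔸} (ha : a * a = 0)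
    (h : a * Y - Y * a - c • (a * Y * a) ≠ 0) : exp (c • a) * Y * exp (-(c • a)) ≠ Y := by
  have h1 : (c • a) * (c • a) = 0 := by rw [smul_mul_smul_comm, ha, smul_zero]
  have h2 : (-(c • a)) * (-(c • a)) = 0 := by rw [neg_mul_neg, h1]
  rw [exp_of_mul_self_eq_zero h1, exp_of_mul_self_eq_zero h2]
  intro hc'
  apply h
  have key : (1 + c • a) * Y * (1 + -(c • a)) - Y = c • (a * Y - Y * a - c • (a * Y * a)) := by
    simp only [mul_add, add_mul, one_mul, mul_one, mul_neg, smul_mul_assoc, mul_smul_comm, smul_sub, smul_add, smul_smul]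
    abel
  have h3 : c • (a * Y - Y * a - c • (a * Y * a)) = 0 := by rw [← key, hc', sub_self]
  exact (smul_eq_zero.mp h3).resolve_left hc

end Witness

/-! ### The hypotheses of §3 hold in `𝓛(ℂ²) ≅ M₂(ℂ)`: `a = E₀₁` (square zero), `Y = E₁₀` -/

section OperatorWitness

/-- `ℂ²` with the sup norm; its bounded operators `ℂ² →L[ℂ] ℂ²` form a complete normed ℂ-algebra (`≅ M₂(ℂ)` with the `ℓ^∞`-operator
norm) — a carrier for the lineage's lattice objects with the LIBRARY's instances. [folklore] -/
abbrev C2 : Type := Fin 2 → ℂ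

/-- The matrix unit `E₀₁ : v ↦ v₁·e₀` as a bounded operator on `ℂ²` (`E₀₁² = 0`). [folklore] -/
def opE₀₁ : C2 →L[ℂ] C2 := (ContinuousLinearMap.proj 1).smulRight (Pi.single 0 1)

/-- The matrix unit `E₁₀ : v ↦ v₀·e₁`. [folklore] -/
def opE₁₀ : C2 →L[ℂ] C2 := (ContinuousLinearMap.proj 0).smulRight (Pi.single 1 1)

/-- `E₀₁v = v₁·e₀`. [folklore] -/
@[simp] theorem opE₀₁_apply (v : C2) : opE₀₁ v = v 1 • Pi.single 0 1 := rfl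

/-- `E₁₀v = v₀·e₁`. [folklore] -/
@[simp] theorem opE₁₀_apply (v : C2) : opE₁₀ v = v 0 • Pi.single 1 1 := rfl

/-- `E₀₁² = 0`. [folklore] -/
theorem opE₀₁_sq : opE₀₁ * opE₀₁ = 0 := by
  ext v i
  simp

/-- `E₀₁E₁₀ ≠ E₁₀E₀₁` (`= E₀₀` resp. `E₁₁`; tested on `e₀`). [folklore] -/
theorem op_noncomm : opE₀₁ * opE₁₀ ≠ opE₁₀ * opE₀₁ := by
  intro h
  have h0 := congr_arg (fun f : C2 →L[ℂ] C2 => f (Pi.single 0 1) 0) h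
  simp at h0

/-- `[E₀₁, E₁₀] − c·E₀₁E₁₀E₀₁ = E₀₀ − E₁₁ − cE₀₁ ≠ 0` for every `c` (its `(0,0)` entry is `1`). [folklore] -/
theorem op_key (c : ℂ) : opE₀₁ * opE₁₀ - opE₁₀ * opE₀₁ - c • (opE₀₁ * opE₁₀ * opE₀₁) ≠ 0 := by
  intro h
  have h0 := congr_arg (fun f : C2 →L[ℂ] C2 => f (Pi.single 0 1) 0) h
  simp at h0

/-- **UNCONDITIONALLY ON THE CARRIER `𝓛(ℂ²)`**: for `η ≠ 0` the bracket of (3.75) at `b` is not determined by the letters on `st(b)`.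
[folklore] [cite: Balaban1985BackgroundPropagators, (3.73) p.405, (3.75) p.405] -/
theorem sum_sBracket₂_not_stLocal_op {η : ℝ} (hη : η ≠ 0) :
    ¬ ∀ (A B A' B' : Fin 2 → ℤ × ℤ → (C2 →L[ℂ] C2)) (μ : Fin 2) (x : ℤ × ℤ),
        (∀ κ z, (κ, z) ∈ stBonds T₂ μ x → A κ z = B κ z) → (∀ κ z, (κ, z) ∈ stBonds T₂ μ x → A' κ z = B' κ z) →
        ∑ ν, sBracket₂ T₂ U₁ η A A' ν μ x = ∑ ν, sBracket₂ T₂ U₁ η B B' ν μ x :=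
  sum_sBracket₂_not_stLocal hη op_noncomm

/-- **UNCONDITIONALLY ON THE CARRIER `𝓛(ℂ²)`**: for `η ≠ 0`, `(V₂(A)A′)(b)` is not determined by the letters on `st(b)`. [folklore]
[cite: Balaban1985BackgroundPropagators, (3.72)–(3.73) p.405, (3.75) p.405] -/
theorem V₂op_not_stLocal_op {η : ℝ} (hη : η ≠ 0) :
    ¬ ∀ (A B A' B' : Fin 2 → ℤ × ℤ → (C2 →L[ℂ] C2)) (μ : Fin 2) (x : ℤ × ℤ),
        (∀ κ z, (κ, z) ∈ stBonds T₂ μ x → A κ z = B κ z) → (∀ κ z, (κ, z) ∈ stBonds T₂ μ x → A' κ z = B' κ z) →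
        V₂op T₂ U₁ η A A' μ x = V₂op T₂ U₁ η B B' μ x :=
  V₂op_not_stLocal (exp_conj_ne_of_mul_self_eq_zero (mul_ne_zero I_ne_zero (ofReal_ne_zero.mpr hη)) opE₀₁_sq (op_key _))

end OperatorWitness

/-! ## §4  (3.72)/(3.73) FOR `F₂`, `V₂` WITH THE LOCAL NORMS -/

section Bounds

variable {𝔸 : Type*} [NormedRing 𝔸] [NormedAlgebra ℂ 𝔸] [CompleteSpace 𝔸] {S : Type*} {ι : Type*}
variable (T : ι → Equiv.Perm S) (U : ι → S → 𝔸ˣ)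

/-- **(3.72) WITH THE LOCAL NORMS, ONE DIRECTION**: the bound `B9Eq375Composition.norm_fRem₂_le` with `‖A(b′)‖ ≤ a` assumed ONLY on
`dirBondsA T ν μ x` and `‖A′(b′)‖ ≤ a′` ONLY on `dirBondsA' T ν μ x` (`a, a′ ≥ 0`): `‖fRem₂_ν(x)‖ ≤ 4ρ⁴s²e^{2s}(3 + 2s + s²e^{2s})·a′`,
`s = ηρ²a` — locality + truncation. [folklore] [cite: Balaban1985BackgroundPropagators, (3.72) p.405, (3.75) p.405] -/
theorem norm_fRem₂_le_loc {η ρ a a' : ℝ} (hη : 0 ≤ η) (hρ : 1 ≤ ρ) (ha : 0 ≤ a) (ha' : 0 ≤ a')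
    (hU : ∀ κ z, ‖(U κ z : 𝔸)‖ ≤ ρ) (hU' : ∀ κ z, ‖(((U κ z)⁻¹ : 𝔸ˣ) : 𝔸)‖ ≤ ρ)
    (A A' : ι → S → 𝔸) (ν μ : ι) (x : S)
    (hA : ∀ κ z, (κ, z) ∈ dirBondsA T ν μ x → ‖A κ z‖ ≤ a) (hA' : ∀ κ z, (κ, z) ∈ dirBondsA' T ν μ x → ‖A' κ z‖ ≤ a') :
    ‖fRem₂ T U η A A' ν μ x‖
      ≤ 4 * ρ ^ 4 * (η * ρ ^ 2 * a) ^ 2 * Real.exp (2 * (η * ρ ^ 2 * a))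
          * (3 + 2 * (η * ρ ^ 2 * a) + (η * ρ ^ 2 * a) ^ 2 * Real.exp (2 * (η * ρ ^ 2 * a))) * a' := by
  rw [fRem₂_congr T U η (B := trunc (dirBondsA T ν μ x) A) (B' := trunc (dirBondsA' T ν μ x) A')
    (fun κ z h => (trunc_of_mem h).symm) (fun κ z h => (trunc_of_mem h).symm)]
  exact norm_fRem₂_le T U hη hρ hU hU' _ _ (norm_trunc_le ha hA) (norm_trunc_le ha' hA') ν μ x

/-- **(3.72) FOR `F₂(A)A′` WITH THE LOCAL NORMS**: `‖(F₂(A)A′)_μ(x)‖ ≤ d·4ρ⁴s²e^{2s}(3 + 2s + s²e^{2s})·a′`, `d = |ι|`, `s = ηρ²a`, with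
`‖A(b′)‖ ≤ a` on `locBondsA(b)` and `‖A′(b′)‖ ≤ a′` on `locBondsA'(b)` only. [folklore]
[cite: Balaban1985BackgroundPropagators, (3.72) p.405, (3.75) p.405] -/
theorem norm_F₂op_le_loc [Fintype ι] {η ρ a a' : ℝ} (hη : 0 ≤ η) (hρ : 1 ≤ ρ) (ha : 0 ≤ a) (ha' : 0 ≤ a')
    (hU : ∀ κ z, ‖(U κ z : 𝔸)‖ ≤ ρ) (hU' : ∀ κ z, ‖(((U κ z)⁻¹ : 𝔸ˣ) : 𝔸)‖ ≤ ρ)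
    (A A' : ι → S → 𝔸) (μ : ι) (x : S)
    (hA : ∀ κ z, (κ, z) ∈ locBondsA T μ x → ‖A κ z‖ ≤ a) (hA' : ∀ κ z, (κ, z) ∈ locBondsA' T μ x → ‖A' κ z‖ ≤ a') :
    ‖F₂op T U η A A' μ x‖
      ≤ Fintype.card ι * (4 * ρ ^ 4 * (η * ρ ^ 2 * a) ^ 2 * Real.exp (2 * (η * ρ ^ 2 * a))
          * (3 + 2 * (η * ρ ^ 2 * a) + (η * ρ ^ 2 * a) ^ 2 * Real.exp (2 * (η * ρ ^ 2 * a))) * a') := by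
  unfold F₂op
  rw [norm_neg]
  calc _ ≤ ∑ ν, ‖fRem₂ T U η A A' ν μ x‖ := norm_sum_le _ _
    _ ≤ ∑ _ν : ι, 4 * ρ ^ 4 * (η * ρ ^ 2 * a) ^ 2 * Real.exp (2 * (η * ρ ^ 2 * a))
          * (3 + 2 * (η * ρ ^ 2 * a) + (η * ρ ^ 2 * a) ^ 2 * Real.exp (2 * (η * ρ ^ 2 * a))) * a' :=
        Finset.sum_le_sum fun ν _ => norm_fRem₂_le_loc T U hη hρ ha ha' hU hU' A A' ν μ x
          (fun κ z h => hA κ z (mem_locBondsA_of_mem h)) (fun κ z h => hA' κ z (mem_locBondsA'_of_mem h))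
    _ = _ := by simp [Finset.sum_const, Finset.card_univ, nsmul_eq_mul]

omit [CompleteSpace 𝔸] in
/-- **(3.73) WITH THE LOCAL NORMS, ONE DIRECTION**: the seven-term estimate of `B9Eq375Composition.norm_sBracket₂_le` re-run with its
twelve letter bounds assumed ONLY on the displayed letters — `‖A‖ ≤ a`, `‖A′‖ ≤ a′` on `dirBonds₂ T ν μ x`, `‖D¹A‖ ≤ g`, `‖D¹A′‖ ≤ g′`
on `dirGrads₂ T ν μ x`: `‖sBracket₂_ν(x)‖ ≤ η((4ρ⁴ + 2ρ² + 2)·a·g′ + 2ρ²(1 + ρ² + ρ⁴)·g·a′)`. [folklore]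
[cite: Balaban1985BackgroundPropagators, (3.73) p.405, (3.75) p.405, (3.39) p.397] -/
theorem norm_sBracket₂_le_loc {η ρ a a' g g' : ℝ} (hη : 0 ≤ η)
    (hU : ∀ κ z, ‖(U κ z : 𝔸)‖ ≤ ρ) (hU' : ∀ κ z, ‖(((U κ z)⁻¹ : 𝔸ˣ) : 𝔸)‖ ≤ ρ)
    (A A' : ι → S → 𝔸) (ν μ : ι) (x : S)
    (hA : ∀ κ z, (κ, z) ∈ dirBonds₂ T ν μ x → ‖A κ z‖ ≤ a) (hA' : ∀ κ z, (κ, z) ∈ dirBonds₂ T ν μ x → ‖A' κ z‖ ≤ a')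
    (hdA : ∀ κ τ z, (κ, τ, z) ∈ dirGrads₂ T ν μ x → ‖covD T U κ (A τ) z‖ ≤ g)
    (hdA' : ∀ κ τ z, (κ, τ, z) ∈ dirGrads₂ T ν μ x → ‖covD T U κ (A' τ) z‖ ≤ g') :
    ‖sBracket₂ T U η A A' ν μ x‖
      ≤ η * ((4 * ρ ^ 4 + 2 * ρ ^ 2 + 2) * a * g' + 2 * ρ ^ 2 * (1 + ρ ^ 2 + ρ ^ 4) * g * a') := by
  -- the twelve letters
  have hAμ : ‖A μ x‖ ≤ a := hA _ _ (by simp [dirBonds₂])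
  have hAf : ‖A ν (T μ x)‖ ≤ a := hA _ _ (by simp [dirBonds₂])
  have hAx : ‖A ν x‖ ≤ a := hA _ _ (by simp [dirBonds₂])
  have hA'f : ‖A' ν (T μ x)‖ ≤ a' := hA' _ _ (by simp [dirBonds₂])
  have hA'fb : ‖A' ν ((T ν).symm (T μ x))‖ ≤ a' := hA' _ _ (by simp [dirBonds₂])
  have hA'b : ‖A' ν ((T ν).symm x)‖ ≤ a' := hA' _ _ (by simp [dirBonds₂])
  have hgμ : ‖covD T U μ (A ν) x‖ ≤ g := hdA _ _ _ (by simp [dirGrads₂])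
  have hgf : ‖covD T U ν (A ν) ((T ν).symm (T μ x))‖ ≤ g := hdA _ _ _ (by simp [dirGrads₂])
  have hgb : ‖covD T U ν (A ν) ((T ν).symm x)‖ ≤ g := hdA _ _ _ (by simp [dirGrads₂])
  have hg'μ : ‖covD T U μ (A' ν) x‖ ≤ g' := hdA' _ _ _ (by simp [dirGrads₂])
  have hg'f : ‖covD T U ν (A' ν) ((T ν).symm (T μ x))‖ ≤ g' := hdA' _ _ _ (by simp [dirGrads₂])
  have hg'b : ‖covD T U ν (A' ν) ((T ν).symm x)‖ ≤ g' := hdA' _ _ _ (by simp [dirGrads₂])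
  have ha : 0 ≤ a := (norm_nonneg _).trans hAμ
  have ha' : 0 ≤ a' := (norm_nonneg _).trans hA'f
  have hg : 0 ≤ g := (norm_nonneg _).trans hgμ
  have hg' : 0 ≤ g' := (norm_nonneg _).trans hg'μ
  have hρ0 : 0 ≤ ρ := (norm_nonneg _).trans (hU ν x)
  have hR : ∀ κ z (Z : 𝔸), ‖R (U κ z) Z‖ ≤ ρ ^ 2 * ‖Z‖ := fun κ z Z => norm_R_le_sq _ (hU κ z) (hU' κ z) Z
  have hRt : ∀ κ z (Z : 𝔸), ‖R (U κ z)⁻¹ Z‖ ≤ ρ ^ 2 * ‖Z‖ := fun κ z Z =>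
    norm_R_le_sq _ (hU' κ z) (by rw [inv_inv]; exact hU κ z) Z
  have hb : ∀ X : 𝔸, ‖X‖ ≤ a → ‖((I * η : ℂ)) • X‖ ≤ η * a := fun X hX => by
    rw [norm_Iη_smul hη]; exact mul_le_mul_of_nonneg_left hX hη
  have hbD : ∀ X : 𝔸, ‖X‖ ≤ g → ‖((I * η : ℂ)) • X‖ ≤ η * g := fun X hX => by
    rw [norm_Iη_smul hη]; exact mul_le_mul_of_nonneg_left hX hη
  -- the `D*`-letters through the forward differences one bond back
  have hds'f : ‖covDstar T U ν (A' ν) (T μ x)‖ ≤ ρ ^ 2 * g' := by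
    rw [covDstar_eq_neg_R_covD, norm_neg]
    exact (hRt ν _ _).trans (mul_le_mul_of_nonneg_left hg'f (by positivity))
  have hds'x : ‖covDstar T U ν (A' ν) x‖ ≤ ρ ^ 2 * g' := by
    rw [covDstar_eq_neg_R_covD, norm_neg]
    exact (hRt ν _ _).trans (mul_le_mul_of_nonneg_left hg'b (by positivity))
  have hdsf : ‖((I * η : ℂ)) • covDstar T U ν (A ν) (T μ x)‖ ≤ η * (ρ ^ 2 * g) := by
    rw [norm_Iη_smul hη, covDstar_eq_neg_R_covD, norm_neg]
    exact mul_le_mul_of_nonneg_left ((hRt ν _ _).trans (mul_le_mul_of_nonneg_left hgf (by positivity))) hη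
  have hdsx : ‖((I * η : ℂ)) • covDstar T U ν (A ν) x‖ ≤ η * (ρ ^ 2 * g) := by
    rw [norm_Iη_smul hη, covDstar_eq_neg_R_covD, norm_neg]
    exact mul_le_mul_of_nonneg_left ((hRt ν _ _).trans (mul_le_mul_of_nonneg_left hgb (by positivity))) hη
  -- the seven terms
  have h1 : ‖-ad (((I * η : ℂ)) • A μ x) (R (U μ x) (covDstar T U ν (A' ν) (T μ x)))‖
      ≤ 2 * (η * a) * (ρ ^ 2 * (ρ ^ 2 * g')) := by
    rw [norm_neg]
    exact (norm_ad_le_of_le (hb _ hAμ) _).trans (mul_le_mul_of_nonneg_left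
      ((hR μ x _).trans (mul_le_mul_of_nonneg_left hds'f (by positivity))) (by positivity))
  have h2 : ‖R (U μ x) (ad (((I * η : ℂ)) • A ν (T μ x)) (covDstar T U ν (A' ν) (T μ x)))‖
      ≤ ρ ^ 2 * (2 * (η * a) * (ρ ^ 2 * g')) :=
    (hR μ x _).trans (mul_le_mul_of_nonneg_left
      ((norm_ad_le_of_le (hb _ hAf) _).trans (mul_le_mul_of_nonneg_left hds'f (by positivity))) (by positivity))
  have h3 : ‖ad (((I * η : ℂ)) • A ν x) (covDstar T U ν (A' ν) x)‖ ≤ 2 * (η * a) * (ρ ^ 2 * g') :=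
    (norm_ad_le_of_le (hb _ hAx) _).trans (mul_le_mul_of_nonneg_left hds'x (by positivity))
  have h4 : ‖ad (((I * η : ℂ)) • A ν x) (covD T U μ (A' ν) x)‖ ≤ 2 * (η * a) * g' :=
    (norm_ad_le_of_le (hb _ hAx) _).trans (mul_le_mul_of_nonneg_left hg'μ (by positivity))
  have h5 : ‖ad (((I * η : ℂ)) • covD T U μ (A ν) x) (R (U μ x) (A' ν (T μ x)))‖ ≤ 2 * (η * g) * (ρ ^ 2 * a') :=
    (norm_ad_le_of_le (hbD _ hgμ) _).trans (mul_le_mul_of_nonneg_left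
      ((hR μ x _).trans (mul_le_mul_of_nonneg_left hA'f (by positivity))) (by positivity))
  have h6 : ‖R (U μ x) (ad (((I * η : ℂ)) • covDstar T U ν (A ν) (T μ x))
        (R (U ν ((T ν).symm (T μ x)))⁻¹ (A' ν ((T ν).symm (T μ x)))))‖
      ≤ ρ ^ 2 * (2 * (η * (ρ ^ 2 * g)) * (ρ ^ 2 * a')) :=
    (hR μ x _).trans (mul_le_mul_of_nonneg_left
      ((norm_ad_le_of_le hdsf _).trans (mul_le_mul_of_nonneg_left
        ((hRt ν _ _).trans (mul_le_mul_of_nonneg_left hA'fb (by positivity))) (by positivity))) (by positivity))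
  have h7 : ‖ad (((I * η : ℂ)) • covDstar T U ν (A ν) x) (R (U ν ((T ν).symm x))⁻¹ (A' ν ((T ν).symm x)))‖
      ≤ 2 * (η * (ρ ^ 2 * g)) * (ρ ^ 2 * a') :=
    (norm_ad_le_of_le hdsx _).trans (mul_le_mul_of_nonneg_left
      ((hRt ν _ _).trans (mul_le_mul_of_nonneg_left hA'b (by positivity))) (by positivity))
  unfold sBracket₂
  refine (norm_sub_le_of_le (norm_add_le_of_le (norm_add_le_of_le (norm_add_le_of_le (norm_sub_le_of_le
    (norm_add_le_of_le h1 h2) h3) h4) h5) h6) h7).trans (le_of_eq ?_)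
  ring

omit [CompleteSpace 𝔸] in
/-- (3.73) FOR THE FIRST-ORDER PART `Σ_ν sBracket₂_ν` WITH THE LOCAL NORMS: `≤ d·η((4ρ⁴ + 2ρ² + 2)ag′ + 2ρ²(1 + ρ² + ρ⁴)ga′)`, every sup on
`locBonds₂(b)`/`locGrads₂(b)` (the factor is `d`, not `d − 1`: the `ν = μ` summand survives, §3). [folklore]
[cite: Balaban1985BackgroundPropagators, (3.73) p.405, (3.75) p.405] -/
theorem norm_sum_sBracket₂_le_loc [Fintype ι] {η ρ a a' g g' : ℝ} (hη : 0 ≤ η)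
    (hU : ∀ κ z, ‖(U κ z : 𝔸)‖ ≤ ρ) (hU' : ∀ κ z, ‖(((U κ z)⁻¹ : 𝔸ˣ) : 𝔸)‖ ≤ ρ)
    (A A' : ι → S → 𝔸) (μ : ι) (x : S)
    (hA : ∀ κ z, (κ, z) ∈ locBonds₂ T μ x → ‖A κ z‖ ≤ a) (hA' : ∀ κ z, (κ, z) ∈ locBonds₂ T μ x → ‖A' κ z‖ ≤ a')
    (hdA : ∀ κ τ z, (κ, τ, z) ∈ locGrads₂ T μ x → ‖covD T U κ (A τ) z‖ ≤ g)
    (hdA' : ∀ κ τ z, (κ, τ, z) ∈ locGrads₂ T μ x → ‖covD T U κ (A' τ) z‖ ≤ g') :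
    ‖∑ ν, sBracket₂ T U η A A' ν μ x‖
      ≤ Fintype.card ι * (η * ((4 * ρ ^ 4 + 2 * ρ ^ 2 + 2) * a * g' + 2 * ρ ^ 2 * (1 + ρ ^ 2 + ρ ^ 4) * g * a')) := by
  calc _ ≤ ∑ ν, ‖sBracket₂ T U η A A' ν μ x‖ := norm_sum_le _ _
    _ ≤ ∑ _ν : ι, η * ((4 * ρ ^ 4 + 2 * ρ ^ 2 + 2) * a * g' + 2 * ρ ^ 2 * (1 + ρ ^ 2 + ρ ^ 4) * g * a') :=
        Finset.sum_le_sum fun ν _ => norm_sBracket₂_le_loc T U hη hU hU' A A' ν μ x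
          (fun κ z h => hA κ z (mem_locBonds₂_of_mem h)) (fun κ z h => hA' κ z (mem_locBonds₂_of_mem h))
          (fun κ τ z h => hdA κ τ z (mem_locGrads₂_of_mem h)) (fun κ τ z h => hdA' κ τ z (mem_locGrads₂_of_mem h))
    _ = _ := by simp [Finset.sum_const, Finset.card_univ, nsmul_eq_mul]

/-- **(3.73) FOR `V₂`, FIRST INEQUALITY, WITH THE LOCAL NORMS** — «|(V₁(A)A′)(b)| ≤ O(1)(|A||∇A′| + |∇A||A′| + |A|²|A′|)» transferred to
`V₂`, all three printed terms, every sup taken on the bonds incident to the endpoints of `b` (`locBonds₂(b)`, `locGrads₂(b)`):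
`‖(V₂(A)A′)_μ(x)‖ ≤ d·[η((4ρ⁴ + 2ρ² + 2)ag′ + 2ρ²(1 + ρ² + ρ⁴)ga′) + 4ρ⁴s²e^{2s}(3 + 2s + s²e^{2s})a′]`, `s = ηρ²a`. [folklore]
[cite: Balaban1985BackgroundPropagators, (3.73) p.405, (3.75) p.405] -/
theorem norm_V₂op_le_loc [Fintype ι] {η ρ a a' g g' : ℝ} (hη : 0 ≤ η) (hρ : 1 ≤ ρ)
    (hU : ∀ κ z, ‖(U κ z : 𝔸)‖ ≤ ρ) (hU' : ∀ κ z, ‖(((U κ z)⁻¹ : 𝔸ˣ) : 𝔸)‖ ≤ ρ)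
    (A A' : ι → S → 𝔸) (μ : ι) (x : S)
    (hA : ∀ κ z, (κ, z) ∈ locBonds₂ T μ x → ‖A κ z‖ ≤ a) (hA' : ∀ κ z, (κ, z) ∈ locBonds₂ T μ x → ‖A' κ z‖ ≤ a')
    (hdA : ∀ κ τ z, (κ, τ, z) ∈ locGrads₂ T μ x → ‖covD T U κ (A τ) z‖ ≤ g)
    (hdA' : ∀ κ τ z, (κ, τ, z) ∈ locGrads₂ T μ x → ‖covD T U κ (A' τ) z‖ ≤ g') :
    ‖V₂op T U η A A' μ x‖
      ≤ Fintype.card ι * (η * ((4 * ρ ^ 4 + 2 * ρ ^ 2 + 2) * a * g' + 2 * ρ ^ 2 * (1 + ρ ^ 2 + ρ ^ 4) * g * a')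
          + 4 * ρ ^ 4 * (η * ρ ^ 2 * a) ^ 2 * Real.exp (2 * (η * ρ ^ 2 * a))
            * (3 + 2 * (η * ρ ^ 2 * a) + (η * ρ ^ 2 * a) ^ 2 * Real.exp (2 * (η * ρ ^ 2 * a))) * a') := by
  have ha : 0 ≤ a := (norm_nonneg _).trans (hA μ x (base_mem_locBonds₂ μ x))
  have ha' : 0 ≤ a' := (norm_nonneg _).trans (hA' μ x (base_mem_locBonds₂ μ x))
  unfold V₂op
  have h1 := norm_sum_sBracket₂_le_loc T U hη hU hU' A A' μ x hA hA' hdA hdA'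
  have h2 := norm_F₂op_le_loc T U hη hρ ha ha' hU hU' A A' μ x
    (fun κ z h => hA κ z (locBondsA_subset μ x h)) (fun κ z h => hA' κ z (locBondsA'_subset μ x h))
  exact (norm_add_le_of_le h1 h2).trans (le_of_eq (by ring))

/-- THE SCALE ARITHMETIC OF (3.72), pure real: `s = ηa ≤ α₁L^{−j} ≤ α₁` (from `a ≤ α₁(L^jη)⁻¹`, `L ≥ 1`, `η > 0`) turns
`d·4s²e^{2s}(3 + 2s + s²e^{2s})a′` into `d·4e^{2α₁}(3 + 2α₁ + α₁²e^{2α₁})α₁²L^{−2j}a′`. [folklore]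
[cite: Balaban1985BackgroundPropagators, (3.72) p.405, (3.37) p.396] -/
theorem scaleF_le {η L α₁ a a' X d : ℝ} {j : ℕ} (hη : 0 < η) (hL : 1 ≤ L) (hd : 0 ≤ d) (ha0 : 0 ≤ a) (ha'0 : 0 ≤ a')
    (ha : a ≤ α₁ * (L ^ j * η)⁻¹)
    (hX : X ≤ d * (4 * 1 ^ 4 * (η * 1 ^ 2 * a) ^ 2 * Real.exp (2 * (η * 1 ^ 2 * a))
          * (3 + 2 * (η * 1 ^ 2 * a) + (η * 1 ^ 2 * a) ^ 2 * Real.exp (2 * (η * 1 ^ 2 * a))) * a')) :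
    X ≤ d * (4 * Real.exp (2 * α₁) * (3 + 2 * α₁ + α₁ ^ 2 * Real.exp (2 * α₁)) * α₁ ^ 2 * ((L ^ j)⁻¹) ^ 2 * a') := by
  have hLj : 1 ≤ L ^ j := one_le_pow₀ hL
  have hLj0 : 0 < L ^ j := lt_of_lt_of_le one_pos hLj
  have hs : η * 1 ^ 2 * a ≤ α₁ * (L ^ j)⁻¹ := by
    calc η * 1 ^ 2 * a = η * a := by ring
      _ ≤ η * (α₁ * (L ^ j * η)⁻¹) := mul_le_mul_of_nonneg_left ha hη.le
      _ = α₁ * (L ^ j)⁻¹ := by field_simp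
  have hs0 : 0 ≤ η * 1 ^ 2 * a := by positivity
  have hα : 0 ≤ α₁ := by
    by_contra hc
    have h1 : α₁ * (L ^ j)⁻¹ < 0 := mul_neg_of_neg_of_pos (lt_of_not_ge hc) (inv_pos.mpr hLj0)
    linarith
  have hs1 : η * 1 ^ 2 * a ≤ α₁ := hs.trans (mul_le_of_le_one_right hα (inv_le_one_of_one_le₀ hLj))
  have hE : Real.exp (2 * (η * 1 ^ 2 * a)) ≤ Real.exp (2 * α₁) := Real.exp_le_exp.mpr (by linarith)
  have hsq : (η * 1 ^ 2 * a) ^ 2 ≤ α₁ ^ 2 * ((L ^ j)⁻¹) ^ 2 := by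
    rw [← mul_pow]; exact pow_le_pow_left₀ hs0 hs 2
  have hsq' : (η * 1 ^ 2 * a) ^ 2 ≤ α₁ ^ 2 := pow_le_pow_left₀ hs0 hs1 2
  have hP : 3 + 2 * (η * 1 ^ 2 * a) + (η * 1 ^ 2 * a) ^ 2 * Real.exp (2 * (η * 1 ^ 2 * a))
      ≤ 3 + 2 * α₁ + α₁ ^ 2 * Real.exp (2 * α₁) := by
    have := mul_le_mul hsq' hE (by positivity) (sq_nonneg α₁)
    linarith
  refine hX.trans (mul_le_mul_of_nonneg_left ?_ hd)
  calc 4 * (1 : ℝ) ^ 4 * (η * 1 ^ 2 * a) ^ 2 * Real.exp (2 * (η * 1 ^ 2 * a))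
          * (3 + 2 * (η * 1 ^ 2 * a) + (η * 1 ^ 2 * a) ^ 2 * Real.exp (2 * (η * 1 ^ 2 * a))) * a'
      ≤ 4 * (1 : ℝ) ^ 4 * (α₁ ^ 2 * ((L ^ j)⁻¹) ^ 2) * Real.exp (2 * α₁)
          * (3 + 2 * α₁ + α₁ ^ 2 * Real.exp (2 * α₁)) * a' := by
        gcongr
    _ = _ := by ring

/-- THE SCALE ARITHMETIC OF (3.73), first-order part, pure real: `ηa ≤ α₁L^{−j}`, `ηg ≤ α₁L^{−2j}` turn `d·η(8ag′ + 6ga′)` into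
`2d·α₁(4L^{−j}g′ + 3L^{−2j}a′)`. [folklore] [cite: Balaban1985BackgroundPropagators, (3.73) p.405, (3.37) p.396] -/
theorem scaleB_le {η L α₁ a a' g g' X d : ℝ} {j : ℕ} (hη : 0 < η) (hL : 1 ≤ L) (hd : 0 ≤ d) (ha'0 : 0 ≤ a') (hg'0 : 0 ≤ g')
    (ha : a ≤ α₁ * (L ^ j * η)⁻¹) (hg : g ≤ η * (α₁ * ((L ^ j * η)⁻¹) ^ 2))
    (hX : X ≤ d * (η * ((4 * 1 ^ 4 + 2 * 1 ^ 2 + 2) * a * g' + 2 * 1 ^ 2 * (1 + 1 ^ 2 + 1 ^ 4) * g * a'))) :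
    X ≤ d * (2 * α₁ * (4 * (L ^ j)⁻¹ * g' + 3 * ((L ^ j)⁻¹) ^ 2 * a')) := by
  have hLj : 1 ≤ L ^ j := one_le_pow₀ hL
  have hLj0 : 0 < L ^ j := lt_of_lt_of_le one_pos hLj
  have h1 : η * a * g' ≤ α₁ * (L ^ j)⁻¹ * g' := by
    have : η * a ≤ α₁ * (L ^ j)⁻¹ := by
      calc η * a ≤ η * (α₁ * (L ^ j * η)⁻¹) := mul_le_mul_of_nonneg_left ha hη.le
        _ = α₁ * (L ^ j)⁻¹ := by field_simp
    exact mul_le_mul_of_nonneg_right this hg'0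
  have h2 : η * g * a' ≤ α₁ * ((L ^ j)⁻¹) ^ 2 * a' := by
    have : η * g ≤ α₁ * ((L ^ j)⁻¹) ^ 2 := by
      calc η * g ≤ η * (η * (α₁ * ((L ^ j * η)⁻¹) ^ 2)) := mul_le_mul_of_nonneg_left hg hη.le
        _ = α₁ * ((L ^ j)⁻¹) ^ 2 := by field_simp
    exact mul_le_mul_of_nonneg_right this ha'0
  refine hX.trans (mul_le_mul_of_nonneg_left ?_ hd)
  nlinarith [h1, h2]

/-- **(3.72) FOR `F₂`, SECOND INEQUALITY, LOCAL NORMS AT THE PRINTED SCALE** (`ρ = 1`; (3.37) on `locBondsA(b)` only: `‖A(b′)‖ ≤ a ≤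
α₁(L^jη)⁻¹`; `L ≥ 1`, `η > 0`): `‖(F₂(A)A′)_μ(x)‖ ≤ d·4e^{2α₁}(3 + 2α₁ + α₁²e^{2α₁})·α₁²·L^{−2j}·a′` with `a′` the maximum of `‖A′‖` over
`locBondsA'(b)` — `η²` times the print's `O(1)α₁²(L^jη)⁻²|A′|`. [folklore] [cite: Balaban1985BackgroundPropagators, (3.72) p.405, (3.37) p.396] -/
theorem norm_F₂op_le_loc_printed [Fintype ι] {η L α₁ a a' : ℝ} {j : ℕ} (hη : 0 < η) (hL : 1 ≤ L) (ha0 : 0 ≤ a) (ha'0 : 0 ≤ a')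
    (hU : ∀ κ z, ‖(U κ z : 𝔸)‖ ≤ 1) (hU' : ∀ κ z, ‖(((U κ z)⁻¹ : 𝔸ˣ) : 𝔸)‖ ≤ 1)
    (A A' : ι → S → 𝔸) (μ : ι) (x : S)
    (hA : ∀ κ z, (κ, z) ∈ locBondsA T μ x → ‖A κ z‖ ≤ a) (ha : a ≤ α₁ * (L ^ j * η)⁻¹)
    (hA' : ∀ κ z, (κ, z) ∈ locBondsA' T μ x → ‖A' κ z‖ ≤ a') :
    ‖F₂op T U η A A' μ x‖
      ≤ Fintype.card ι * (4 * Real.exp (2 * α₁) * (3 + 2 * α₁ + α₁ ^ 2 * Real.exp (2 * α₁))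
          * α₁ ^ 2 * ((L ^ j)⁻¹) ^ 2 * a') :=
  scaleF_le hη hL (Nat.cast_nonneg _) ha0 ha'0 ha (norm_F₂op_le_loc T U hη.le le_rfl ha0 ha'0 hU hU' A A' μ x hA hA')

/-- **(3.73) FOR `V₂`, SECOND INEQUALITY, LOCAL NORMS AT THE PRINTED SCALE** — «≤ O(1)α₁((L^jη)⁻¹|∇A′| + (L^jη)⁻²|A′|), b ∈ Ω_j» — for the
print's `V₂` (first-order part + `F_{2,k}`), `ρ = 1`, (3.37) assumed ONLY on the bonds incident to the endpoints of `b` (`a ≤ α₁(L^jη)⁻¹`,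
`g ≤ η·α₁(L^jη)⁻²`; `L ≥ 1`, `η > 0`): `‖(V₂(A)A′)_μ(x)‖ ≤ d·α₁·[8L^{−j}·g′ + (6 + 4α₁e^{2α₁}(3 + 2α₁ + α₁²e^{2α₁}))·L^{−2j}·a′]` — `η²` times
the printed right side with `O(1)` explicit (`g′ = η|∇A′|`; «depending on d only» once `α₁ ≤ 1`). [folklore]
[cite: Balaban1985BackgroundPropagators, (3.73) p.405, (3.75) p.405, (3.37) p.396] -/
theorem norm_V₂op_le_loc_printed [Fintype ι] {η L α₁ a a' g g' : ℝ} {j : ℕ} (hη : 0 < η) (hL : 1 ≤ L)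
    (hU : ∀ κ z, ‖(U κ z : 𝔸)‖ ≤ 1) (hU' : ∀ κ z, ‖(((U κ z)⁻¹ : 𝔸ˣ) : 𝔸)‖ ≤ 1)
    (A A' : ι → S → 𝔸) (μ : ι) (x : S)
    (hA : ∀ κ z, (κ, z) ∈ locBonds₂ T μ x → ‖A κ z‖ ≤ a) (ha : a ≤ α₁ * (L ^ j * η)⁻¹)
    (hA' : ∀ κ z, (κ, z) ∈ locBonds₂ T μ x → ‖A' κ z‖ ≤ a')
    (hdA : ∀ κ τ z, (κ, τ, z) ∈ locGrads₂ T μ x → ‖covD T U κ (A τ) z‖ ≤ g) (hg : g ≤ η * (α₁ * ((L ^ j * η)⁻¹) ^ 2))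
    (hdA' : ∀ κ τ z, (κ, τ, z) ∈ locGrads₂ T μ x → ‖covD T U κ (A' τ) z‖ ≤ g') :
    ‖V₂op T U η A A' μ x‖
      ≤ Fintype.card ι * (α₁ * (8 * (L ^ j)⁻¹ * g'
          + (6 + 4 * α₁ * Real.exp (2 * α₁) * (3 + 2 * α₁ + α₁ ^ 2 * Real.exp (2 * α₁))) * ((L ^ j)⁻¹) ^ 2 * a')) := by
  have ha0 : 0 ≤ a := (norm_nonneg _).trans (hA μ x (base_mem_locBonds₂ μ x))
  have ha'0 : 0 ≤ a' := (norm_nonneg _).trans (hA' μ x (base_mem_locBonds₂ μ x))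
  have hg'0 : 0 ≤ g' := (norm_nonneg _).trans (hdA' μ μ x (mem_locGrads₂_of_mem (ν := μ) (by simp [dirGrads₂])))
  unfold V₂op
  have h1 := scaleB_le hη hL (Nat.cast_nonneg _) ha'0 hg'0 ha hg
    (norm_sum_sBracket₂_le_loc T U hη.le hU hU' A A' μ x hA hA' hdA hdA')
  have h2 := scaleF_le hη hL (Nat.cast_nonneg _) ha0 ha'0 ha (norm_F₂op_le_loc T U hη.le le_rfl ha0 ha'0 hU hU' A A' μ x
    (fun κ z h => hA κ z (locBondsA_subset μ x h)) (fun κ z h => hA' κ z (locBondsA'_subset μ x h)))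
  exact (norm_add_le_of_le h1 h2).trans (le_of_eq (by ring))

end Bounds

/-! ## §5  Sanity -/

section Examples

variable {𝔸 : Type*} [NormedRing 𝔸] [NormedAlgebra ℂ 𝔸] [CompleteSpace 𝔸] {S : Type*} {ι : Type*}
variable (T : ι → Equiv.Perm S) (U : ι → S → 𝔸ˣ)

/-- An argument vanishing on the bonds arriving at `x` and on the bonds at `x + e_μ` is not seen at `b`: `(V₂(A)A′)(b) = 0`. -/
example [Fintype ι] (η : ℝ) (A A' : ι → S → 𝔸) (μ : ι) (x : S) (h : ∀ κ z, (κ, z) ∈ locBondsA' T μ x → A' κ z = 0) :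
    V₂op T U η A A' μ x = 0 := by
  rw [V₂op_congr T U η (B := A) (B' := 0) (fun _ _ _ => rfl) h, V₂op_zero_right]

/-- On `ℤ²` the placement hypothesis holds: the locality set of (3.75) at `b = ⟨x, x + e_μ⟩` is inside `st(b) ∪ {b − e_μ, b, b + e_μ}`. -/
example (μ : Fin 2) (x : ℤ × ℤ) :
    locBonds₂ T₂ μ x ⊆ stBonds T₂ μ x ∪ {(μ, (T₂ μ).symm x), (μ, x), (μ, T₂ μ x)} :=
  locBonds₂_subset_stBonds_union (T₂_comm μ x)

/-- No fluctuation (`η = 0`), no correction: the witness value `e^{0}Ye^{0} − Y` is `0`. -/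
example (a Y : 𝔸) : V₂op T₂ U₁ 0 (δ (0, (0, 0)) a) (δ (0, (1, 0)) Y) 0 (0, 0) = 0 := by
  rw [V₂op_witness]; simp

end Examples

end Literature.MathematicalPhysics.QuantumFieldTheory.Balaban1983to89.B9Eq375Locality

end
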